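import Literature.NumberTheory.LFunctions.BombieriWeilTruncations
import Literature.NumberTheory.QuadraticForms.LandherrHermitianDiagonalForms
import Mathlib.Analysis.Matrix.Spectrum
import Mathlib.Analysis.Matrix.PosDef
import HarnessLib

/-!
# Bombieri 2000, Theorems 9 and 8 — proved (`Bombieri2000.theorem9_holds`, `Bombieri2000.theorem8_holds`)

Topic `Literature/NumberTheory/LFunctions`; namespace `Literature.NumberTheory.LFunctions.Bombieri2000`.
This file DISCHARGES the named facts `Bombieri2000.theorem9` and (§I, appended) `Bombieri2000.theorem8`
of `BombieriWeilTruncations.lean`; the description of the Theorem 9 part follows first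
(E. Bombieri, *Remarks on Weil's quadratic functional in the theory of prime numbers, I*,
Rend. Mat. Acc. Lincei (9) 11 (2000) 183–233, §9 Theorem 9): for a finite multiset `Γ ⊂ ℂ` closed
under `γ ↦ γ̄` with multiplicity and `E ⊂ ℝ` a finite union of bounded closed intervals, the matrix
`𝒦_E(Γ) = [∫_E e^{i(γ−γ')u} du]` has exactly as many negative eigenvalues (real roots of the
characteristic polynomial, with algebraic multiplicity) as there are distinct conjugate pairs
`{γ, γ̄}` in `Γ`; and for symmetric `E` the sector matrices `𝒦_E^±(Γ)` on Bombieri's half set `Γ₀`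
have as many negative eigenvalues as there are distinct pairs with `Re γ > 0`, resp. `Re γ ≥ 0`.

## The proof formalised here

Not the printed proof (a deformation / continuity argument in the entries, §§8–9), but the
route through the Gram structure that Bombieri records in (11.3) ("`𝒦_E(Γ)` is self-adjoint and
`≥ 0` for the hermitian form `⟨z, w⟩ = Σ z_γ w̄_γ̄`"), made quantitative by Sylvester's law of inertia:

* §A For a hermitian matrix `negEigenvalueCount` is the number of negative eigenvalues
  (`Matrix.IsHermitian.roots_charpoly_eq_eigenvalues`); **Sylvester's law of inertia**
  `card_neg_eigenvalues_eq_of_congr` (`Cᴴ A C = B`, `C` invertible ⇒ same negative count), from two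
  applications of the inequality `Landherr.card_pos_le_of_congr` of
  `Literature/NumberTheory/QuadraticForms/LandherrHermitianDiagonalForms.lean` (reused, not
  re-proved); a hermitian involution `P` has `2·#{λ < 0} = dim − tr P`.
* §B **Reduction theorem** `two_mul_negEigenvalueCount_submatrix`: if `Q` is a hermitian involution
  and `G ≻ 0` on a finite set of VALUES, and `val` labels SLOTS surjectively with multiplicities
  constant along the support of `Q`, then `2 · negEigenvalueCount [(Q G)(val i, val j)] = card − Re tr Q`
  (slot/value incidence matrix, `Matrix.charpoly_mul_comm'` for rectangular matrices, the diagonal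
  multiplicity matrix `D = D^{1/2} D^{1/2}` commuting with `Q`, `D^{1/2} G D^{1/2} = B Bᴴ` by the
  spectral theorem, and `Q B Bᴴ ~ Bᴴ Q B`, which is hermitian and congruent to `Q`).
* §C **Gram matrices** `[∫_E φ̄_a φ_b]` of continuous families that are linearly independent on every
  sub-interval of `E` are positive definite (`posDef_gram`: the form is `∫_E ‖Σ x_v φ_v‖²`, positive
  by continuity near a point of a non-degenerate interval inside `E`); **distinct exponentials are
  independent on any interval** (`eq_zero_of_exp_sum_eq_zero`: all derivative sums vanish on the
  interval by induction with `Filter.EventuallyEq.deriv_eq`, then the Vandermonde matrix of the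
  `−iw_v` at the midpoint, `Matrix.eq_zero_of_forall_pow_sum_mul_pow_eq_zero`).
* §D Signed permutation matrices of involutions (hermitian, square to `1`, trace = signed number of
  fixed points).
* §E The **counting lemma** `negEigenvalueCount_eq_conjPairCount_of_posDef` (shared with Theorem 8, §I):
  a slot matrix `M_{ij} = G(γ̄_i, γ_j)` with `G ≻ 0` on the distinct values is `(P_σ · G)[val, val]`,
  `σ` = conjugation, so §B applies and `card − #{real values} = 2 · #{Im γ > 0}` finishes. Part 1 of
  Theorem 9: `G` = the Gram matrix of `u ↦ e^{−iγu}` (`KE_eq_integral_conj_mul`).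
* §F–§G Part 2 (symmetric `E`, `u ↦ −u` preserves `volume.restrict E`):
  `K_E^+(x,y) = 2∫_E cos(xu)cos(yu)`, `K_E^−(x,y) = 2∫_E sin(xu)sin(yu)` (`KEpm_one_eq`,
  `KEpm_neg_one_eq`); on the distinct values of `Γ₀` these are `P_τ · Gram(√2 cos)` and
  `S P_τ · Gram(√2 sin)` with `τ` = conjugation on `Re > 0`, identity on `iℝ`, and `S = −1` exactly on
  `iℝ`; cosine/sine families with frequencies in a half set are independent (reduction to
  exponential pairs indexed by `V ⊕ V`); the counts are `#{Re > 0, Im > 0}` and `#{Im > 0, Re ≥ 0}`.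
* §H `theorem9_holds`.

Remarks recorded by the formalisation: of the hypotheses carried by the typed statement, the
symmetry `γ ↦ −γ` (with multiplicity) and Lemma 12's proviso `0 ∉ Γ` are not needed; only closure
under conjugation with multiplicity is used (it makes the multiplicities `σ`-invariant and the set of
values conjugation-closed).

## §I Theorem 8 (§8): `ℋ(Γ; t)` (appended; `theorem8_holds`)

"The number of negative eigenvalues of the matrix `ℋ(Γ; t)` equals the number of distinct complex
conjugate pairs `(γ, γ̄)` in `Γ`" (`t > 0`, `Γ` closed under conjugation with multiplicity, `γ ≠ ±i/2`,
as typed in `Bombieri2000.theorem8`). Again not the printed deformation argument but the Gram structure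
Bombieri records in (8.14)–(8.15): multiplying (8.6) by `(¼ + γ²) z̄_γ̄` and summing gives
`λ Σ w_γ w̄_γ̄ = ¼∫_{−t}^{t}|F|² + ∫_{−t}^{t}|F'|²` with `F = Z − Ae^{u/2} − Be^{−u/2}`, `F(±t) = 0`. Made
into an identity of kernels: with `A_a = E(½−ia)/E(1)`, `B_a = E(½+ia)/E(1)`, `E(s) = e^{st} − e^{−st}`
(`Bombieri2000.expDiff`), `ψ_a = (e^{−iau} − A_a e^{u/2} − B_a e^{−u/2})/(2(¼ + a²))` and
`Dψ_a = (−ia e^{−iau} − ½A_a e^{u/2} + ½B_a e^{−u/2})/(¼ + a²)`,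
**`H(x, y, t) = ∫_{−t}^{t} conj(ψ_{x̄}) ψ_y + ∫_{−t}^{t} conj(Dψ_{x̄}) Dψ_y`** (`H_eq_gram`: both sides are
evaluated in closed form — seven exponential integrals `c ∫_{−t}^{t} e^{cu} du = E(c)` — and compared
as rational functions of `e^{t/2}`, `e^{ixt}`, `e^{iyt}` via the product identity
`E(½−iy)E(½+ix) − E(½+iy)E(½−ix) = E(1)E(i(x−y))`). Hence `ℋ(Γ; t) = (P_σ · G')[val, val]` with
`G' = ¼·Gram(ψ) + Gram(Dψ)` on the distinct values, positive definite because the `ψ_v` are exponential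
sums over the distinct exponents `{−iv} ∪ {±½}` (the independence of `e^{±u/2}`, `e^{−iγu}` invoked in
the proof of Lemma 10; this is where `γ ≠ ±i/2` enters), and the counting lemma extracted from §E
(`negEigenvalueCount_eq_conjPairCount_of_posDef`, the reduction theorem of §B plus the pair count)
gives the statement. The symmetry `γ ↦ −γ` is again unused.

## References

* E. Bombieri, *Remarks on Weil's quadratic functional in the theory of prime numbers, I*,
  Atti Accad. Naz. Lincei Rend. Lincei (9) Mat. Appl. 11 (2000), no. 3, 183–233: §9 Theorem 9,
  (9.1), (9.6)–(9.7), Lemma 12; §11 (11.3); §7 (7.3), §8 (8.5)–(8.6), (8.14)–(8.15), Lemma 10,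
  Theorem 8. [cite: Bombieri2000Weil, §9 Theorem 9 and §8 Theorem 8]
* W. Landherr, Abh. Math. Sem. Univ. Hamburg 11 (1936) 245–248 (Sylvester's law of inertia in the
  form used by `LandherrHermitianDiagonalForms.lean`). [cite: Landherr1936HermitianForms]
-/

noncomputable section

open Matrix Complex Polynomial Finset
open scoped ComplexConjugate ComplexOrder

namespace Literature.NumberTheory.LFunctions

namespace Bombieri2000

/-! ## §A Linear algebra: negative eigenvalue counts, Sylvester's law of inertia, involutions -/

section LinearAlgebra

variable {n : Type} [Fintype n] [DecidableEq n]

/-- For a hermitian matrix, `negEigenvalueCount` is the number of negative eigenvalues. [folklore] -/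
private theorem negEigenvalueCount_eq_card {A : Matrix n n ℂ} (hA : A.IsHermitian) :
    negEigenvalueCount A = (univ.filter fun i ↦ hA.eigenvalues i < 0).card := by
  unfold negEigenvalueCount
  rw [hA.roots_charpoly_eq_eigenvalues, Multiset.countP_map, ← Finset.filter_val, Finset.card_val]
  congr 1
  refine Finset.filter_congr fun i _ ↦ ?_
  simp only [Function.comp_apply]
  rw [← RCLike.re_to_complex, ← RCLike.im_to_complex, RCLike.ofReal_re, RCLike.ofReal_im]
  simp only [true_and]

/-- Matrix form of the spectral theorem: `Uᴴ A U = diag(λ)` with `U Uᴴ = 1 = Uᴴ U`. [folklore] -/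
private theorem exists_unitary_diag {A : Matrix n n ℂ} (hA : A.IsHermitian) :
    ∃ U : Matrix n n ℂ, U * Uᴴ = 1 ∧ Uᴴ * U = 1 ∧
      Uᴴ * A * U = diagonal (fun i ↦ ((hA.eigenvalues i : ℝ) : ℂ)) := by
  refine ⟨(hA.eigenvectorUnitary : Matrix n n ℂ), ?_, ?_, ?_⟩
  · have h := Unitary.coe_mul_star_self hA.eigenvectorUnitary
    rwa [Unitary.coe_star, Matrix.star_eq_conjTranspose] at h
  · have h := Unitary.coe_star_mul_self hA.eigenvectorUnitary
    rw [Matrix.star_eq_conjTranspose] at h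
    exact h
  · have h := hA.conjStarAlgAut_star_eigenvectorUnitary
    rw [Unitary.conjStarAlgAut_star_apply, Matrix.star_eq_conjTranspose] at h
    exact h

/-- **Sylvester's law of inertia, the inequality**: if `Cᴴ A C = B` with `A`, `B` hermitian, then `B`
has at most as many negative eigenvalues as `A`. [folklore] -/
private theorem card_neg_eigenvalues_le_of_congr {A B C : Matrix n n ℂ} (hA : A.IsHermitian)
    (hB : B.IsHermitian) (h : Cᴴ * A * C = B) :
    (univ.filter fun i ↦ hB.eigenvalues i < 0).card ≤
      (univ.filter fun i ↦ hA.eigenvalues i < 0).card := by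
  obtain ⟨U, hU1, hU2, hUA⟩ := exists_unitary_diag hA
  obtain ⟨W, hW1, hW2, hWB⟩ := exists_unitary_diag hB
  -- `A = U diag(λ_A) Uᴴ`
  have hAeq : U * diagonal (fun i ↦ ((hA.eigenvalues i : ℝ) : ℂ)) * Uᴴ = A := by
    rw [← hUA]
    calc U * (Uᴴ * A * U) * Uᴴ = (U * Uᴴ) * A * (U * Uᴴ) := by simp only [Matrix.mul_assoc]
      _ = A := by rw [hU1, Matrix.one_mul, Matrix.mul_one]
  set G : Matrix n n ℂ := Uᴴ * C * W with hG
  have hcongr : Gᴴ * diagonal (fun i ↦ -((hA.eigenvalues i : ℝ) : ℂ)) * G =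
      diagonal (fun i ↦ -((hB.eigenvalues i : ℝ) : ℂ)) := by
    have e1 : Gᴴ * diagonal (fun i ↦ ((hA.eigenvalues i : ℝ) : ℂ)) * G =
        diagonal (fun i ↦ ((hB.eigenvalues i : ℝ) : ℂ)) := by
      calc Gᴴ * diagonal (fun i ↦ ((hA.eigenvalues i : ℝ) : ℂ)) * G
          = Wᴴ * Cᴴ * (U * diagonal (fun i ↦ ((hA.eigenvalues i : ℝ) : ℂ)) * Uᴴ) * C * W := by
            rw [hG]
            simp only [Matrix.conjTranspose_mul, Matrix.conjTranspose_conjTranspose,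
              Matrix.mul_assoc]
        _ = Wᴴ * (Cᴴ * A * C) * W := by rw [hAeq]; simp only [Matrix.mul_assoc]
        _ = diagonal (fun i ↦ ((hB.eigenvalues i : ℝ) : ℂ)) := by rw [h, hWB]
    have hneg : ∀ d : n → ℂ, diagonal (fun i ↦ -d i) = -diagonal d := fun d ↦ by
      rw [← Matrix.diagonal_neg]
    rw [hneg, hneg, Matrix.mul_neg, Matrix.neg_mul, e1]
  have key := Literature.NumberTheory.QuadraticForms.Landherr.card_pos_le_of_congr hcongr
  have hre : ∀ (e : n → ℝ) (i : n), (0 < (-((e i : ℝ) : ℂ)).re) ↔ e i < 0 := fun e i ↦ by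
    rw [Complex.neg_re, Complex.ofReal_re, neg_pos]
  simp only [hre] at key
  exact key

/-- **Sylvester's law of inertia**: congruent hermitian matrices (`Cᴴ A C = B`, `C` invertible) have
the same number of negative eigenvalues. [folklore] -/
private theorem card_neg_eigenvalues_eq_of_congr {A B C : Matrix n n ℂ} (hA : A.IsHermitian)
    (hB : B.IsHermitian) (hC : IsUnit C.det) (h : Cᴴ * A * C = B) :
    (univ.filter fun i ↦ hB.eigenvalues i < 0).card =
      (univ.filter fun i ↦ hA.eigenvalues i < 0).card := by
  refine le_antisymm (card_neg_eigenvalues_le_of_congr hA hB h) ?_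
  refine card_neg_eigenvalues_le_of_congr hB hA (C := C⁻¹) ?_
  have h1 : C * C⁻¹ = 1 := Matrix.mul_nonsing_inv C hC
  have h2 : C⁻¹ᴴ * Cᴴ = 1 := by rw [← Matrix.conjTranspose_mul, h1, Matrix.conjTranspose_one]
  rw [← h]
  calc C⁻¹ᴴ * (Cᴴ * A * C) * C⁻¹ = (C⁻¹ᴴ * Cᴴ) * A * (C * C⁻¹) := by simp only [Matrix.mul_assoc]
    _ = A := by rw [h1, h2, Matrix.one_mul, Matrix.mul_one]

/-- The eigenvalues of a hermitian involution (`P² = 1`) are `±1`. [folklore] -/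
private theorem eigenvalues_eq_one_or_of_mul_self_eq_one {P : Matrix n n ℂ} (hP : P.IsHermitian)
    (h1 : P * P = 1) (i : n) : hP.eigenvalues i = 1 ∨ hP.eigenvalues i = -1 := by
  have hv := hP.mulVec_eigenvectorBasis i
  set v : n → ℂ := ⇑(hP.eigenvectorBasis i) with hvdef
  have hv2 : P *ᵥ (P *ᵥ v) = ((hP.eigenvalues i) * (hP.eigenvalues i) : ℝ) • v := by
    rw [hv, Matrix.mulVec_smul, hv, smul_smul]
  rw [Matrix.mulVec_mulVec, h1, Matrix.one_mulVec] at hv2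
  have hvne : v ≠ 0 := by
    intro h0
    have h1' := (hP.eigenvectorBasis.orthonormal).1 i
    have hn : ‖hP.eigenvectorBasis i‖ = 0 := by
      rw [EuclideanSpace.norm_eq]
      simp only [show ∀ j, hP.eigenvectorBasis i j = v j from fun j ↦ rfl, h0, Pi.zero_apply,
        norm_zero, ne_eq, OfNat.ofNat_ne_zero, not_false_eq_true, zero_pow, sum_const_zero,
        Real.sqrt_zero]
    rw [hn] at h1'
    exact zero_ne_one h1'
  obtain ⟨j, hj⟩ := Function.ne_iff.mp hvne
  have hj' := congrFun hv2 j
  rw [Pi.smul_apply, Complex.real_smul] at hj'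
  have hsq : (hP.eigenvalues i) * (hP.eigenvalues i) = 1 := by
    have e : ((hP.eigenvalues i * hP.eigenvalues i : ℝ) : ℂ) * v j = 1 * v j := by
      rw [one_mul]; exact hj'.symm
    exact_mod_cast mul_right_cancel₀ hj e
  exact mul_self_eq_one_iff.mp hsq

/-- For a hermitian involution `P`, twice the number of negative eigenvalues is `dim − tr P`. [folklore] -/
private theorem two_mul_card_neg_eigenvalues_of_mul_self_eq_one {P : Matrix n n ℂ} (hP : P.IsHermitian)
    (h1 : P * P = 1) :
    2 * ((univ.filter fun i ↦ hP.eigenvalues i < 0).card : ℝ) = Fintype.card n - P.trace.re := by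
  have htr' : P.trace.re = ∑ i, hP.eigenvalues i := by
    rw [hP.trace_eq_sum_eigenvalues, Complex.re_sum]
    refine Finset.sum_congr rfl fun i _ ↦ ?_
    exact Complex.ofReal_re _
  rw [htr']
  have hsplit : ∀ i, hP.eigenvalues i =
      1 - 2 * (if hP.eigenvalues i < 0 then (1 : ℝ) else 0) := by
    intro i
    rcases eigenvalues_eq_one_or_of_mul_self_eq_one hP h1 i with h | h
    · rw [h, if_neg (by norm_num)]; ring
    · rw [h, if_pos (by norm_num)]; ring
  rw [Finset.sum_congr rfl fun i _ ↦ hsplit i, Finset.sum_sub_distrib, Finset.sum_const,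
    Finset.card_univ, nsmul_eq_mul, mul_one, ← Finset.mul_sum, Finset.sum_boole]
  ring

end LinearAlgebra

/-! ## §B Reduction: value-indexed kernels `(Q·G)[val i, val j]` with `G ≻ 0` and `Q` a hermitian involution -/

section Reduction

variable {ι V : Type} [Fintype ι] [DecidableEq ι] [Fintype V] [DecidableEq V]

/-- Negative real roots are unchanged by a factor `X ^ k`. [folklore] -/
private theorem countP_roots_X_pow_mul (k : ℕ) {p : ℂ[X]} (hp : p ≠ 0) :
    (X ^ k * p).roots.countP (fun z : ℂ ↦ z.im = 0 ∧ z.re < 0) =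
      p.roots.countP (fun z : ℂ ↦ z.im = 0 ∧ z.re < 0) := by
  rw [Polynomial.roots_mul (mul_ne_zero (pow_ne_zero _ X_ne_zero) hp), Multiset.countP_add,
    Polynomial.roots_X_pow, Multiset.nsmul_singleton]
  have h0 : (Multiset.replicate k (0 : ℂ)).countP (fun z : ℂ ↦ z.im = 0 ∧ z.re < 0) = 0 := by
    rw [Multiset.countP_eq_zero]
    intro z hz
    rw [Multiset.eq_of_mem_replicate hz]
    simp
  rw [h0, zero_add]

/-- `negEigenvalueCount (A B) = negEigenvalueCount (B A)` for rectangular `A`, `B` (the non-zero spectra of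
`AB` and `BA` agree). [folklore] -/
private theorem negEigenvalueCount_mul_comm (A : Matrix ι V ℂ) (B : Matrix V ι ℂ) :
    negEigenvalueCount (A * B) = negEigenvalueCount (B * A) := by
  unfold negEigenvalueCount
  have h := congrArg (fun q : ℂ[X] ↦ q.roots.countP (fun z : ℂ ↦ z.im = 0 ∧ z.re < 0))
    (Matrix.charpoly_mul_comm' A B)
  rwa [countP_roots_X_pow_mul _ (Matrix.charpoly_monic _).ne_zero,
    countP_roots_X_pow_mul _ (Matrix.charpoly_monic _).ne_zero] at h

omit [Fintype ι] [DecidableEq ι] in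
/-- A value-indexed matrix is the conjugate of the value matrix by the slot/value incidence matrix. [folklore] -/
private theorem submatrix_eq_incidence_mul (M : Matrix V V ℂ) (val : ι → V) :
    M.submatrix val val =
      Matrix.of (fun (i : ι) (v : V) ↦ if val i = v then (1 : ℂ) else 0) * M *
        (Matrix.of (fun (i : ι) (v : V) ↦ if val i = v then (1 : ℂ) else 0))ᵀ := by
  ext i j
  simp only [Matrix.submatrix_apply, Matrix.mul_apply, Matrix.transpose_apply, Matrix.of_apply,
    ite_mul, one_mul, zero_mul, mul_ite, mul_one, mul_zero, Finset.sum_ite_eq, Finset.mem_univ,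
    if_true]

omit [DecidableEq ι] [Fintype V] in
/-- The Gram matrix of the incidence matrix is the diagonal matrix of multiplicities. [folklore] -/
private theorem incidence_transpose_mul_incidence (val : ι → V) :
    (Matrix.of (fun (i : ι) (v : V) ↦ if val i = v then (1 : ℂ) else 0))ᵀ *
        Matrix.of (fun (i : ι) (v : V) ↦ if val i = v then (1 : ℂ) else 0) =
      diagonal (fun v ↦ ((univ.filter fun i ↦ val i = v).card : ℂ)) := by
  ext v w
  simp only [Matrix.mul_apply, Matrix.transpose_apply, Matrix.of_apply, Matrix.diagonal_apply]
  by_cases hvw : v = w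
  · subst hvw
    rw [if_pos rfl]
    have : ∀ i, ((if val i = v then (1 : ℂ) else 0) * if val i = v then 1 else 0) =
        if val i = v then 1 else 0 := fun i ↦ by split_ifs <;> simp
    simp only [this, Finset.sum_boole]
  · rw [if_neg hvw]
    refine Finset.sum_eq_zero fun i _ ↦ ?_
    by_cases h1 : val i = v
    · rw [if_pos h1, if_neg (fun h2 ↦ hvw (h1.symm.trans h2)), mul_zero]
    · rw [if_neg h1, zero_mul]

omit [Fintype V] [DecidableEq V] in
/-- `star (r : ℂ) = r` for real `r`. [folklore] -/
private theorem star_ofReal' (r : ℝ) : star (r : ℂ) = r := Complex.conj_ofReal r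

/-- A positive definite hermitian matrix is `B Bᴴ` with `B` invertible. [folklore] -/
private theorem exists_mul_conjTranspose_eq_of_posDef {G : Matrix V V ℂ} (hG : G.PosDef) :
    ∃ B : Matrix V V ℂ, IsUnit B.det ∧ B * Bᴴ = G := by
  obtain ⟨U, hU1, hU2, hUG⟩ := exists_unitary_diag hG.1
  have hpos := hG.eigenvalues_pos
  set R : Matrix V V ℂ := diagonal (fun v ↦ ((Real.sqrt (hG.1.eigenvalues v) : ℝ) : ℂ)) with hR
  have hRR : R * Rᴴ = diagonal (fun v ↦ ((hG.1.eigenvalues v : ℝ) : ℂ)) := by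
    rw [hR, Matrix.diagonal_conjTranspose, Matrix.diagonal_mul_diagonal]
    congr 1
    funext v
    rw [Pi.star_apply, star_ofReal', ← Complex.ofReal_mul, Real.mul_self_sqrt (hpos v).le]
  have hGeq : U * diagonal (fun v ↦ ((hG.1.eigenvalues v : ℝ) : ℂ)) * Uᴴ = G := by
    rw [← hUG]
    calc U * (Uᴴ * G * U) * Uᴴ = (U * Uᴴ) * G * (U * Uᴴ) := by simp only [Matrix.mul_assoc]
      _ = G := by rw [hU1, Matrix.one_mul, Matrix.mul_one]
  refine ⟨U * R, ?_, ?_⟩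
  · rw [Matrix.det_mul]
    refine IsUnit.mul (Matrix.isUnit_det_of_right_inverse hU1) ?_
    rw [hR, Matrix.det_diagonal]
    refine isUnit_iff_ne_zero.mpr (Finset.prod_ne_zero_iff.mpr fun v _ ↦ ?_)
    exact_mod_cast (Real.sqrt_pos.mpr (hpos v)).ne'
  · rw [Matrix.conjTranspose_mul, ← hGeq, ← hRR]
    simp only [Matrix.mul_assoc]

/-- **Reduction theorem.** Let `Q` be a hermitian involution and `G ≻ 0` on a finite set of VALUES `V`,
and `val : ι → V` a surjective labelling of SLOTS whose multiplicities are constant along the support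
of `Q`. Then the slot matrix `[(Q G)(val i, val j)]` has `(card V − tr Q)/2` negative eigenvalues
(counted with algebraic multiplicity; they are real). [folklore] -/
private theorem two_mul_negEigenvalueCount_submatrix {Q G : Matrix V V ℂ} (hQ : Q.IsHermitian)
    (hQ1 : Q * Q = 1) (hG : G.PosDef) (val : ι → V) (hval : Function.Surjective val)
    (hQm : ∀ v w, Q v w ≠ 0 →
      (univ.filter fun i ↦ val i = v).card = (univ.filter fun i ↦ val i = w).card) :
    2 * (negEigenvalueCount ((Q * G).submatrix val val) : ℝ) = Fintype.card V - Q.trace.re := by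
  -- multiplicities and their square roots
  set m : V → ℕ := fun v ↦ (univ.filter fun i ↦ val i = v).card with hm
  have hmpos : ∀ v, 0 < m v := fun v ↦ by
    obtain ⟨i, hi⟩ := hval v
    exact Finset.card_pos.mpr ⟨i, Finset.mem_filter.mpr ⟨Finset.mem_univ _, hi⟩⟩
  set E : Matrix ι V ℂ := Matrix.of (fun (i : ι) (v : V) ↦ if val i = v then (1 : ℂ) else 0)
    with hE
  set Dh : Matrix V V ℂ := diagonal (fun v ↦ ((Real.sqrt (m v) : ℝ) : ℂ)) with hDh
  have hDhDh : Dh * Dh = Eᵀ * E := by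
    rw [hE, incidence_transpose_mul_incidence, hDh, Matrix.diagonal_mul_diagonal]
    congr 1
    funext v
    rw [← Complex.ofReal_mul, Real.mul_self_sqrt (Nat.cast_nonneg _), Complex.ofReal_natCast]
  have hDhH : Dhᴴ = Dh := by
    rw [hDh, Matrix.diagonal_conjTranspose]
    congr 1
    funext v
    rw [Pi.star_apply, star_ofReal']
  -- `Q` commutes with `Dh`
  have hQDh : Q * Dh = Dh * Q := by
    ext v w
    rw [hDh, Matrix.mul_diagonal, Matrix.diagonal_mul]
    by_cases h0 : Q v w = 0
    · rw [h0, mul_zero, zero_mul]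
    · rw [mul_comm, show m w = m v from (hQm v w h0).symm]
  -- step 1: slots → values with multiplicity
  have step1 : negEigenvalueCount ((Q * G).submatrix val val) =
      negEigenvalueCount (Q * (Dh * G * Dh)) := by
    rw [submatrix_eq_incidence_mul, ← hE, Matrix.mul_assoc, negEigenvalueCount_mul_comm,
      Matrix.mul_assoc, ← hDhDh, ← Matrix.mul_assoc, ← Matrix.mul_assoc,
      negEigenvalueCount_mul_comm, ← Matrix.mul_assoc, ← Matrix.mul_assoc, ← hQDh]
    simp only [Matrix.mul_assoc]
  -- step 2: `Dh G Dh ≻ 0`, factor it as `B Bᴴ`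
  have hG' : (Dh * G * Dh).PosDef := by
    have hinj : Function.Injective Dh.mulVec := by
      intro x y hxy
      funext v
      have h := congrFun hxy v
      rw [hDh, Matrix.mulVec_diagonal, Matrix.mulVec_diagonal] at h
      have hne : ((Real.sqrt (m v) : ℝ) : ℂ) ≠ 0 := by
        exact_mod_cast (Real.sqrt_pos.mpr (by exact_mod_cast hmpos v)).ne'
      exact mul_left_cancel₀ hne h
    have h := hG.conjTranspose_mul_mul_same hinj
    rwa [hDhH] at h
  obtain ⟨B, hBu, hBG⟩ := exists_mul_conjTranspose_eq_of_posDef hG'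
  -- step 3: `Q B Bᴴ ~ Bᴴ Q B`, a hermitian matrix congruent to `Q`
  have hM : (Bᴴ * Q * B).IsHermitian := Matrix.isHermitian_conjTranspose_mul_mul B hQ
  have step3 : negEigenvalueCount (Q * (Dh * G * Dh)) = negEigenvalueCount (Bᴴ * Q * B) := by
    rw [← hBG, ← Matrix.mul_assoc, negEigenvalueCount_mul_comm, ← Matrix.mul_assoc]
  rw [step1, step3, negEigenvalueCount_eq_card hM, card_neg_eigenvalues_eq_of_congr hQ hM hBu rfl]
  exact two_mul_card_neg_eigenvalues_of_mul_self_eq_one hQ hQ1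

end Reduction

/-! ## §C Gram matrices over `L²(E)` and linear independence of exponentials -/

section Gram

open MeasureTheory Set Filter
open scoped Topology

variable {V : Type} [Fintype V] [DecidableEq V]

omit [DecidableEq V] in
/-- A finite union of bounded closed intervals is compact and measurable and contains a
non-degenerate interval. [folklore] -/
private theorem IsFiniteUnionOfIntervals.elim {E : Set ℝ} (hE : IsFiniteUnionOfIntervals E) :
    IsCompact E ∧ MeasurableSet E ∧ ∃ a b : ℝ, a < b ∧ Icc a b ⊆ E := by
  obtain ⟨s, hs, hlt, rfl⟩ := hE
  refine ⟨s.isCompact_biUnion fun p _ ↦ isCompact_Icc,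
    s.measurableSet_biUnion fun p _ ↦ measurableSet_Icc, ?_⟩
  obtain ⟨p, hp⟩ := hs
  exact ⟨p.1, p.2, hlt p hp, Set.subset_biUnion_of_mem (u := fun q : ℝ × ℝ ↦ Icc q.1 q.2) hp⟩

omit [Fintype V] [DecidableEq V] in
/-- A continuous non-negative function which is positive somewhere inside an interval contained in
`E` has positive integral over `E`. [folklore] -/
private theorem setIntegral_pos_of_continuous {g : ℝ → ℝ} (hg : Continuous g) (hg0 : ∀ u, 0 ≤ g u)
    {E : Set ℝ} (hEc : IsCompact E) {a b u₀ : ℝ} (hI : Icc a b ⊆ E)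
    (hu₀ : u₀ ∈ Ioo a b) (hpos : 0 < g u₀) : 0 < ∫ u in E, g u := by
  -- a neighbourhood of `u₀` inside `(a, b)` on which `g > g u₀ / 2`
  have hev : ∀ᶠ u in 𝓝 u₀, g u₀ / 2 < g u :=
    hg.continuousAt.eventually (lt_mem_nhds (by linarith))
  obtain ⟨δ, hδ, hball⟩ := Metric.eventually_nhds_iff.mp hev
  set δ' : ℝ := min δ (min (u₀ - a) (b - u₀)) with hδ'
  have hδ'pos : 0 < δ' := lt_min hδ (lt_min (by linarith [hu₀.1]) (by linarith [hu₀.2]))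
  have hS : Ioo (u₀ - δ') (u₀ + δ') ⊆ E := by
    intro u hu
    refine hI ⟨?_, ?_⟩
    · have : δ' ≤ u₀ - a := le_trans (min_le_right _ _) (min_le_left _ _)
      linarith [hu.1]
    · have : δ' ≤ b - u₀ := le_trans (min_le_right _ _) (min_le_right _ _)
      linarith [hu.2]
  have hgS : ∀ u ∈ Ioo (u₀ - δ') (u₀ + δ'), g u₀ / 2 ≤ g u := by
    intro u hu
    refine (hball ?_).le
    rw [Real.dist_eq, abs_lt]
    have : δ' ≤ δ := min_le_left _ _
    constructor <;> linarith [hu.1, hu.2]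
  have hgE : IntegrableOn g E := hg.continuousOn.integrableOn_compact hEc
  calc (0 : ℝ) < (g u₀ / 2) * (2 * δ') := by positivity
    _ = ∫ _ in Ioo (u₀ - δ') (u₀ + δ'), g u₀ / 2 := by
        rw [setIntegral_const, smul_eq_mul, measureReal_def, Real.volume_Ioo,
          ENNReal.toReal_ofReal (by linarith)]
        ring
    _ ≤ ∫ u in Ioo (u₀ - δ') (u₀ + δ'), g u :=
        setIntegral_mono_on (integrableOn_const (by simp [Real.volume_Ioo]))
          (hgE.mono_set hS) measurableSet_Ioo hgS
    _ ≤ ∫ u in E, g u :=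
        setIntegral_mono_set hgE (Eventually.of_forall hg0) (Eventually.of_forall hS)

omit [DecidableEq V] in
/-- **Gram matrices are positive definite on independent families.** For continuous
`φ_v : ℝ → ℂ` whose restrictions to every open interval inside `E` are linearly independent, the
matrix `[∫_E conj(φ_a) φ_b]` is positive definite. [folklore] -/
private theorem posDef_gram {E : Set ℝ} (hE : IsFiniteUnionOfIntervals E) (φ : V → ℝ → ℂ)
    (hφ : ∀ v, Continuous (φ v))
    (hind : ∀ a b : ℝ, a < b → Icc a b ⊆ E → ∀ x : V → ℂ,
      (∀ u ∈ Ioo a b, ∑ v, x v * φ v u = 0) → x = 0) :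
    (Matrix.of fun a b : V ↦ ∫ u in E, conj (φ a u) * φ b u).PosDef := by
  obtain ⟨hEc, hEm, a, b, hab, hI⟩ := hE.elim
  have hint : ∀ a b : V, IntegrableOn (fun u ↦ conj (φ a u) * φ b u) E :=
    fun a b ↦ (((hφ a).star).mul (hφ b)).continuousOn.integrableOn_compact hEc
  refine Matrix.PosDef.of_dotProduct_mulVec_pos ?_ fun x hx ↦ ?_
  · -- hermitian
    refine Matrix.IsHermitian.ext fun i j ↦ ?_
    rw [Matrix.of_apply, Matrix.of_apply, Complex.star_def, ← integral_conj]
    refine integral_congr_ae (Eventually.of_forall fun u ↦ ?_)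
    simp only [map_mul, starRingEnd_self_apply, mul_comm]
  · -- the quadratic form is `∫_E ‖Σ x_v φ_v‖²`
    set h : ℝ → ℂ := fun u ↦ ∑ v, x v * φ v u with hh
    have hcont : Continuous h := continuous_finsetSum _ fun v _ ↦ continuous_const.mul (hφ v)
    have hq : star x ⬝ᵥ ((Matrix.of fun a b : V ↦ ∫ u in E, conj (φ a u) * φ b u) *ᵥ x) =
        ((∫ u in E, ‖h u‖ ^ 2 : ℝ) : ℂ) := by
      have h1 : ∀ u, (∑ a, ∑ b, star (x a) * (conj (φ a u) * φ b u) * x b) =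
          ((‖h u‖ ^ 2 : ℝ) : ℂ) := by
        intro u
        rw [Complex.ofReal_pow, ← Complex.conj_mul', hh]
        simp only [map_sum, map_mul]
        rw [Finset.sum_mul]
        refine Finset.sum_congr rfl fun a _ ↦ ?_
        rw [Finset.mul_sum]
        refine Finset.sum_congr rfl fun b _ ↦ ?_
        rw [Complex.star_def]
        ring
      rw [← integral_complex_ofReal]
      simp_rw [← h1]
      rw [integral_finsetSum _ fun a _ ↦ ?_]
      · simp only [dotProduct, Matrix.mulVec, Matrix.of_apply, Pi.star_apply, Finset.mul_sum]
        refine Finset.sum_congr rfl fun a _ ↦ ?_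
        rw [integral_finsetSum _ fun b _ ↦ ?_]
        · refine Finset.sum_congr rfl fun b _ ↦ ?_
          rw [← integral_mul_const, ← integral_const_mul]
          refine integral_congr_ae (Eventually.of_forall fun u ↦ ?_)
          simp only [mul_assoc]
        · exact ((hint a b).const_mul _).mul_const _
      · exact integrable_finsetSum _ fun b _ ↦ ((hint a b).const_mul _).mul_const _
    rw [hq, Complex.zero_lt_real]
    -- positivity: `h` does not vanish identically on `(a, b)`
    by_contra hle
    have hzero : ∫ u in E, ‖h u‖ ^ 2 = 0 :=
      le_antisymm (not_lt.mp hle) (setIntegral_nonneg hEm fun u _ ↦ by positivity)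
    have hvan : ∀ u ∈ Ioo a b, h u = 0 := by
      intro u hu
      by_contra hne
      have hpos : 0 < ‖h u‖ ^ 2 := by positivity
      have := setIntegral_pos_of_continuous (g := fun u ↦ ‖h u‖ ^ 2) (by fun_prop)
        (fun u ↦ by positivity) hEc hI hu hpos
      linarith
    exact hx (hind a b hab hI x hvan)

omit [DecidableEq V] in
/-- **Distinct exponentials are linearly independent on any interval**: if
`Σ_v x_v e^{−i w_v u} = 0` on an open interval with the `w_v` distinct, then `x = 0` (differentiate
`card V − 1` times at the midpoint and invert the Vandermonde matrix of the `−i w_v`). [folklore] -/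
private theorem eq_zero_of_exp_sum_eq_zero (w : V → ℂ) (hw : Function.Injective w) {a b : ℝ} (hab : a < b)
    (x : V → ℂ) (h : ∀ u ∈ Ioo a b, ∑ v, x v * cexp (-(I * w v) * u) = 0) : x = 0 := by
  -- all "derivative sums" vanish on `(a, b)`
  have hder : ∀ (k : ℕ) (u : ℝ),
      HasDerivAt (fun u : ℝ ↦ ∑ v, x v * (-(I * w v)) ^ k * cexp (-(I * w v) * u))
        (∑ v, x v * (-(I * w v)) ^ (k + 1) * cexp (-(I * w v) * u)) u := by
    intro k u
    refine HasDerivAt.fun_sum fun v _ ↦ ?_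
    have h1 : HasDerivAt (fun u : ℝ ↦ cexp (-(I * w v) * u))
        (cexp (-(I * w v) * u) * (-(I * w v) * 1)) u := by
      refine HasDerivAt.cexp ?_
      exact ((hasDerivAt_id u).ofReal_comp).const_mul _
    refine (h1.const_mul (x v * (-(I * w v)) ^ k)).congr_deriv ?_
    ring
  have hvan : ∀ (k : ℕ), ∀ u ∈ Ioo a b,
      ∑ v, x v * (-(I * w v)) ^ k * cexp (-(I * w v) * u) = 0 := by
    intro k
    induction k with
    | zero => intro u hu; simpa using h u hu
    | succ k ih =>
      intro u hu
      rw [← (hder k u).deriv]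
      have hloc : (fun u : ℝ ↦ ∑ v, x v * (-(I * w v)) ^ k * cexp (-(I * w v) * u)) =ᶠ[𝓝 u]
          fun _ ↦ (0 : ℂ) :=
        eventuallyEq_of_mem (Ioo_mem_nhds hu.1 hu.2) fun u' hu' ↦ ih u' hu'
      rw [hloc.deriv_eq, deriv_const]
  -- Vandermonde at the midpoint
  set c : ℝ := (a + b) / 2 with hc
  have hcI : c ∈ Ioo a b := ⟨by rw [hc]; linarith, by rw [hc]; linarith⟩
  set e := Fintype.equivFin V with he
  set y : Fin (Fintype.card V) → ℂ := fun j ↦ x (e.symm j) * cexp (-(I * w (e.symm j)) * c)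
    with hy
  set f : Fin (Fintype.card V) → ℂ := fun j ↦ -(I * w (e.symm j)) with hf
  have hfinj : Function.Injective f := by
    intro j j' hjj'
    have h2 : w (e.symm j) = w (e.symm j') :=
      mul_left_cancel₀ I_ne_zero (neg_injective hjj')
    exact e.symm.injective (hw h2)
  have hy0 : y = 0 := by
    refine Matrix.eq_zero_of_forall_pow_sum_mul_pow_eq_zero hfinj fun i ↦ ?_
    have h3 := hvan i c hcI
    rw [← e.symm.sum_comp] at h3
    rw [← h3]
    refine Finset.sum_congr rfl fun j _ ↦ ?_
    rw [hy, hf]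
    ring
  funext v
  have h4 : x v * cexp (-(I * w v) * c) = 0 := by
    have h5 := congrFun hy0 (e v)
    simp only [hy, Pi.zero_apply, Equiv.symm_apply_apply] at h5
    exact h5
  rcases mul_eq_zero.mp h4 with h0 | h0
  · rw [Pi.zero_apply]; exact h0
  · exact absurd h0 (Complex.exp_ne_zero _)

end Gram

/-! ## §D Signed permutation matrices of involutions -/

section SignedPerm

variable {V : Type} [Fintype V] [DecidableEq V]

/-- Left multiplication by the signed permutation matrix of `τ`. [folklore] -/
private theorem signedPerm_mul (τ : V → V) (s : V → ℂ) (G : Matrix V V ℂ) :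
    Matrix.of (fun v v' : V ↦ if v' = τ v then s v else 0) * G =
      Matrix.of fun v v' ↦ s v * G (τ v) v' := by
  ext v v'
  simp only [Matrix.mul_apply, Matrix.of_apply, ite_mul, zero_mul, Finset.sum_ite_eq',
    Finset.mem_univ, if_true]

omit [Fintype V] in
/-- Entries of the signed permutation matrix off the graph of `τ` vanish. [folklore] -/
private theorem signedPerm_apply_ne_zero {τ : V → V} {s : V → ℂ} {v v' : V}
    (h : Matrix.of (fun v v' : V ↦ if v' = τ v then s v else 0) v v' ≠ 0) : v' = τ v := by
  rw [Matrix.of_apply] at h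
  by_contra hne
  exact h (if_neg hne)

omit [Fintype V] in
/-- The signed permutation matrix of an involution with a `τ`-invariant sign `±1` is hermitian. [folklore] -/
private theorem signedPerm_isHermitian {τ : V → V} (hτ : Function.Involutive τ) {s : V → ℂ}
    (hs : ∀ v, s v = 1 ∨ s v = -1) (hsτ : ∀ v, s (τ v) = s v) :
    (Matrix.of (fun v v' : V ↦ if v' = τ v then s v else 0)).IsHermitian := by
  refine Matrix.IsHermitian.ext fun v v' ↦ ?_
  simp only [Matrix.of_apply]
  have hiff : v = τ v' ↔ v' = τ v := by
    constructor
    · intro h; rw [h, hτ]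
    · intro h; rw [h, hτ]
  by_cases h : v = τ v'
  · rw [if_pos h, if_pos (hiff.mp h)]
    have : s v' = s v := by rw [h, hsτ]
    rw [this]
    rcases hs v with h1 | h1 <;> rw [h1] <;> simp
  · rw [if_neg h, if_neg (fun h' ↦ h (hiff.mpr h')), star_zero]

/-- The signed permutation matrix of an involution with signs `±1` squares to `1`. [folklore] -/
private theorem signedPerm_mul_self {τ : V → V} (hτ : Function.Involutive τ) {s : V → ℂ}
    (hs : ∀ v, s v = 1 ∨ s v = -1) (hsτ : ∀ v, s (τ v) = s v) :
    Matrix.of (fun v v' : V ↦ if v' = τ v then s v else 0) *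
      Matrix.of (fun v v' : V ↦ if v' = τ v then s v else 0) = 1 := by
  rw [signedPerm_mul]
  ext v v'
  simp only [Matrix.of_apply, hτ v, Matrix.one_apply, hsτ]
  by_cases h : v' = v
  · subst h
    rw [if_pos rfl, if_pos rfl]
    rcases hs v' with h1 | h1 <;> rw [h1] <;> norm_num
  · rw [if_neg h, if_neg (fun h' ↦ h h'.symm), mul_zero]

/-- The trace of a signed permutation matrix is the signed count of fixed points. [folklore] -/
private theorem signedPerm_trace (τ : V → V) (s : V → ℂ) :
    (Matrix.of (fun v v' : V ↦ if v' = τ v then s v else 0)).trace =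
      ∑ v ∈ univ.filter (fun v ↦ τ v = v), s v := by
  simp only [Matrix.trace, Matrix.diag, Matrix.of_apply, Finset.sum_filter]
  refine Finset.sum_congr rfl fun v _ ↦ ?_
  simp only [eq_comm]

end SignedPerm

/-! ## §E Theorem 9, first part: `𝒦_E(Γ)` -/

section General

open MeasureTheory Set

/-- The kernel `K_E(x, y)` as a Gram entry of the exponentials `u ↦ e^{−iyu}` against `u ↦ e^{−i x̄ u}`. [folklore] -/
private theorem KE_eq_integral_conj_mul (E : Set ℝ) (x y : ℂ) :
    KE E x y = ∫ u in E, conj (cexp (-(I * conj x) * u)) * cexp (-(I * y) * u) := by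
  unfold KE
  refine integral_congr_ae (Filter.Eventually.of_forall fun u ↦ ?_)
  simp only
  rw [← Complex.exp_conj, ← Complex.exp_add, map_mul, map_neg, map_mul, Complex.conj_I,
    Complex.conj_conj, Complex.conj_ofReal]
  ring_nf

/-- Conjugation-invariance with multiplicity: the fibres of `γ` over `z` and `z̄` have the same
size. [folklore] -/
private theorem card_fiber_conj {ι : Type} [Fintype ι] (γ : ι → ℂ)
    (hc : FamilyInvariant γ (starRingEnd ℂ)) (z : ℂ) :
    (univ.filter fun i ↦ γ i = z).card = (univ.filter fun i ↦ γ i = conj z).card := by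
  obtain ⟨σ, hσ⟩ := hc
  rw [← Fintype.card_subtype, ← Fintype.card_subtype]
  refine Fintype.card_congr (Equiv.subtypeEquiv σ fun i ↦ ?_)
  rw [hσ i]
  constructor
  · intro h; rw [h]
  · intro h
    rw [← Complex.conj_conj (γ i), h, Complex.conj_conj]

open scoped Classical in
/-- **Counting lemma** (the common Gram core of Theorems 8 and 9, cf. (8.14) and (11.3)): if
`M_{ij} = G(γ̄_i, γ_j)` for a kernel `G` whose matrix on the distinct values of a family `γ` (closed
under conjugation with multiplicity) is positive definite, then `M` has exactly as many negative
eigenvalues as there are distinct conjugate pairs in the family. [cite: Bombieri2000Weil, §8 (8.14) and §11 (11.3)] -/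
private theorem negEigenvalueCount_eq_conjPairCount_of_posDef {ι : Type} [Fintype ι] [DecidableEq ι]
    (γ : ι → ℂ) (hc : FamilyInvariant γ (starRingEnd ℂ)) (M : Matrix ι ι ℂ) (Gf : ℂ → ℂ → ℂ)
    (hM : ∀ i j, M i j = Gf (conj (γ i)) (γ j))
    (hG : (Matrix.of fun a b : {z // z ∈ (univ : Finset ι).image γ} ↦ Gf a.1 b.1).PosDef) :
    negEigenvalueCount M = conjPairCount γ := by
  -- the set of values and its conjugation
  set S : Finset ℂ := univ.image γ with hS
  have hmemS : ∀ z ∈ S, conj z ∈ S := by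
    intro z hz
    obtain ⟨i, -, rfl⟩ := Finset.mem_image.mp hz
    obtain ⟨σ, hσ⟩ := hc
    exact Finset.mem_image.mpr ⟨σ i, Finset.mem_univ _, hσ i⟩
  set cj : {z // z ∈ S} → {z // z ∈ S} := fun v ↦ ⟨conj v.1, hmemS v.1 v.2⟩ with hcj
  have hcjv : ∀ v, (cj v).1 = conj v.1 := fun v ↦ rfl
  have hcjinv : Function.Involutive cj := fun v ↦ Subtype.ext (by rw [hcjv, hcjv, Complex.conj_conj])
  set val : ι → {z // z ∈ S} := fun i ↦ ⟨γ i, Finset.mem_image_of_mem γ (Finset.mem_univ i)⟩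
    with hval
  have hsurj : Function.Surjective val := by
    rintro ⟨z, hz⟩
    obtain ⟨i, -, rfl⟩ := Finset.mem_image.mp hz
    exact ⟨i, rfl⟩
  -- the value matrix and the permutation matrix of conjugation
  set G : Matrix {z // z ∈ S} {z // z ∈ S} ℂ := Matrix.of fun a b ↦ Gf a.1 b.1 with hGdef
  set Q : Matrix {z // z ∈ S} {z // z ∈ S} ℂ :=
    Matrix.of fun v v' ↦ if v' = cj v then (1 : ℂ) else 0 with hQ
  have hs1 : ∀ v : {z // z ∈ S}, (fun _ ↦ (1 : ℂ)) v = 1 ∨ (fun _ ↦ (1 : ℂ)) v = -1 :=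
    fun v ↦ Or.inl rfl
  have hQh : Q.IsHermitian := signedPerm_isHermitian hcjinv hs1 (fun _ ↦ rfl)
  have hQ1 : Q * Q = 1 := signedPerm_mul_self hcjinv hs1 (fun _ ↦ rfl)
  -- `M = (Q G)[val, val]`
  have hK : M = (Q * G).submatrix val val := by
    ext i j
    rw [hQ, signedPerm_mul, Matrix.submatrix_apply, Matrix.of_apply, one_mul, hM, hGdef,
      Matrix.of_apply]
  -- multiplicities are conjugation invariant
  have hfib : ∀ v : {z // z ∈ S},
      (univ.filter fun i ↦ val i = v).card = (univ.filter fun i ↦ γ i = v.1).card :=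
    fun v ↦ congrArg Finset.card (Finset.filter_congr fun i _ ↦ Subtype.ext_iff)
  have hmult : ∀ v w, Q v w ≠ 0 →
      (univ.filter fun i ↦ val i = v).card = (univ.filter fun i ↦ val i = w).card := by
    intro v w hvw
    have hw : w = cj v := signedPerm_apply_ne_zero hvw
    subst hw
    rw [hfib, hfib, hcjv]
    exact card_fiber_conj γ hc v.1
  have key := two_mul_negEigenvalueCount_submatrix hQh hQ1 hG val hsurj hmult
  rw [← hK, hQ, signedPerm_trace] at key
  -- counting: `card V − #{v real} = 2 #{Im v > 0}`
  have hfix : (univ.filter fun v : {z // z ∈ S} ↦ cj v = v) = univ.filter fun v ↦ v.1.im = 0 := by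
    refine Finset.filter_congr fun v _ ↦ ?_
    rw [← Complex.conj_eq_iff_im, ← hcjv]
    exact ⟨fun h ↦ congrArg Subtype.val h, fun h ↦ Subtype.ext h⟩
  have hsum : (∑ v ∈ univ.filter (fun v : {z // z ∈ S} ↦ cj v = v), (fun _ ↦ (1 : ℂ)) v).re =
      ((univ.filter fun v : {z // z ∈ S} ↦ v.1.im = 0).card : ℝ) := by
    rw [hfix, Finset.sum_const, nsmul_eq_mul, mul_one]
    simp
  rw [hsum] at key
  have hcardV : (Fintype.card {z // z ∈ S} : ℝ) =
      (univ.filter fun v : {z // z ∈ S} ↦ v.1.im = 0).card +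
        ((univ.filter fun v : {z // z ∈ S} ↦ 0 < v.1.im).card +
          (univ.filter fun v : {z // z ∈ S} ↦ v.1.im < 0).card) := by
    have h1 := Finset.card_filter_add_card_filter_not (s := (univ : Finset {z // z ∈ S}))
      (fun v ↦ v.1.im = 0)
    have h2 := Finset.card_filter_add_card_filter_not
      (s := (univ : Finset {z // z ∈ S}).filter fun v ↦ ¬ v.1.im = 0) (fun v ↦ 0 < v.1.im)
    rw [Finset.filter_filter, Finset.filter_filter] at h2
    have e1 : (univ.filter fun v : {z // z ∈ S} ↦ ¬ v.1.im = 0 ∧ 0 < v.1.im) =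
        univ.filter fun v ↦ 0 < v.1.im :=
      Finset.filter_congr fun v _ ↦ ⟨fun h ↦ h.2, fun h ↦ ⟨h.ne', h⟩⟩
    have e2 : (univ.filter fun v : {z // z ∈ S} ↦ ¬ v.1.im = 0 ∧ ¬ 0 < v.1.im) =
        univ.filter fun v ↦ v.1.im < 0 :=
      Finset.filter_congr fun v _ ↦
        ⟨fun h ↦ lt_of_le_of_ne (not_lt.mp h.2) h.1, fun h ↦ ⟨h.ne, not_lt.mpr h.le⟩⟩
    rw [e1, e2] at h2
    rw [← Finset.card_univ, ← h1, ← h2]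
    push_cast
    ring
  have hneg : (univ.filter fun v : {z // z ∈ S} ↦ v.1.im < 0).card =
      (univ.filter fun v : {z // z ∈ S} ↦ 0 < v.1.im).card := by
    refine Finset.card_bij' (fun v _ ↦ cj v) (fun v _ ↦ cj v) (fun v hv ↦ ?_) (fun v hv ↦ ?_)
      (fun v _ ↦ hcjinv v) (fun v _ ↦ hcjinv v)
    · rw [Finset.mem_filter] at hv ⊢
      refine ⟨Finset.mem_univ _, ?_⟩
      rw [hcjv, Complex.conj_im]
      linarith [hv.2]
    · rw [Finset.mem_filter] at hv ⊢
      refine ⟨Finset.mem_univ _, ?_⟩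
      rw [hcjv, Complex.conj_im]
      linarith [hv.2]
  have hpair : (univ.filter fun v : {z // z ∈ S} ↦ 0 < v.1.im).card = conjPairCount γ := by
    unfold conjPairCount
    rw [← hS, ← Fintype.card_subtype, ← Fintype.card_coe (S.filter fun z ↦ 0 < z.im)]
    refine Fintype.card_congr ⟨fun v ↦ ⟨v.1.1, Finset.mem_filter.mpr ⟨v.1.2, v.2⟩⟩,
      fun z ↦ ⟨⟨z.1, (Finset.mem_filter.mp z.2).1⟩, (Finset.mem_filter.mp z.2).2⟩,
      fun v ↦ rfl, fun z ↦ rfl⟩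
  rw [hcardV, hneg, hpair] at key
  have : (negEigenvalueCount M : ℝ) = conjPairCount γ := by linarith
  exact_mod_cast this

open scoped Classical in
/-- **Theorem 9, first part** (§9): for a finite multiset `Γ` closed under conjugation with
multiplicity and `E` a finite union of bounded closed intervals, the number of negative eigenvalues of
`𝒦_E(Γ)` is the number of distinct conjugate pairs in `Γ`. (Proof by the Gram factorisation
`𝒦_E = P_σ · G` of (11.3), Sylvester's law of inertia and the linear independence of distinct
exponentials — replacing the deformation argument of the printed proof.) [cite: Bombieri2000Weil, §9 Theorem 9] -/
theorem negEigenvalueCount_KMat {E : Set ℝ} (hE : IsFiniteUnionOfIntervals E)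
    {ι : Type} [Fintype ι] [DecidableEq ι] (γ : ι → ℂ)
    (hc : FamilyInvariant γ (starRingEnd ℂ)) :
    negEigenvalueCount (KMat E γ) = conjPairCount γ := by
  -- the Gram matrix of the exponentials `u ↦ e^{−ivu}` on the distinct values is positive definite
  have hGpos := posDef_gram hE
    (fun (v : {z // z ∈ (univ : Finset ι).image γ}) (u : ℝ) ↦ cexp (-(I * v.1) * u)) (fun v ↦ by fun_prop)
    fun a b hab _ x hx ↦
      eq_zero_of_exp_sum_eq_zero (fun v : {z // z ∈ (univ : Finset ι).image γ} ↦ v.1)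
        Subtype.val_injective hab x hx
  exact negEigenvalueCount_eq_conjPairCount_of_posDef γ hc (KMat E γ)
    (fun a b ↦ ∫ u in E, conj (cexp (-(I * a) * u)) * cexp (-(I * b) * u))
    (fun i j ↦ by rw [KMat_apply, KE_eq_integral_conj_mul]) hGpos

end General

/-! ## §F Symmetric `E`: the sector kernels `𝒦_E^±` -/

section Symmetric

open MeasureTheory Set Filter
open scoped Topology

/-- For symmetric `E`, `∫_E g(−u) du = ∫_E g(u) du`. [folklore] -/
private theorem setIntegral_comp_neg_of_symmetric {E : Set ℝ} (hs : IsSymmetricSet E) (g : ℝ → ℂ) :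
    ∫ u in E, g (-u) = ∫ u in E, g u := by
  have A : MeasurableEmbedding fun x : ℝ ↦ -x :=
    (Homeomorph.neg ℝ).isClosedEmbedding.measurableEmbedding
  have h := MeasurableEmbedding.setIntegral_map (μ := volume) A g E
  rw [Measure.map_neg_eq_self (volume : Measure ℝ)] at h
  have hpre : (fun x : ℝ ↦ -x) ⁻¹' E = E := by
    ext u
    rw [Set.mem_preimage]
    exact (hs u).symm
  rw [hpre] at h
  exact h.symm

/-- For symmetric `E`, `∫_E e^{itu} du = ∫_E cos(tu) du`. [folklore] -/
private theorem setIntegral_cexp_eq_cos {E : Set ℝ} (hE : IsFiniteUnionOfIntervals E) (hs : IsSymmetricSet E)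
    (t : ℂ) : ∫ u in E, cexp (I * t * u) = ∫ u in E, Complex.cos (t * u) := by
  obtain ⟨hEc, -, -⟩ := hE.elim
  have hint : ∀ c : ℂ, IntegrableOn (fun u : ℝ ↦ cexp (c * u)) E := fun c ↦
    (by fun_prop : Continuous fun u : ℝ ↦ cexp (c * u)).continuousOn.integrableOn_compact hEc
  have h1 : ∫ u in E, cexp (I * t * u) = ∫ u in E, cexp (-(I * t) * u) := by
    rw [← setIntegral_comp_neg_of_symmetric hs (fun u ↦ cexp (-(I * t) * u))]
    refine integral_congr_ae (Eventually.of_forall fun u ↦ ?_)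
    simp only [Complex.ofReal_neg, mul_neg, neg_mul, neg_neg]
  have h2 : (∫ u in E, cexp (I * t * u)) + (∫ u in E, cexp (-(I * t) * u)) =
      2 * ∫ u in E, Complex.cos (t * u) := by
    rw [← integral_add (hint _) (hint _), ← integral_const_mul]
    refine integral_congr_ae (Eventually.of_forall fun u ↦ ?_)
    dsimp only
    rw [Complex.two_cos]
    ring_nf
  rw [← h1, ← two_mul] at h2
  exact mul_left_cancel₀ two_ne_zero h2

/-- For symmetric `E`: `K_E^+(x, y) = 2 ∫_E cos(xu) cos(yu) du`. [cite: Bombieri2000Weil, §9 (9.6)] -/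
theorem KEpm_one_eq {E : Set ℝ} (hE : IsFiniteUnionOfIntervals E) (hs : IsSymmetricSet E)
    (x y : ℂ) : KEpm 1 E x y = ∫ u in E, 2 * (Complex.cos (x * u) * Complex.cos (y * u)) := by
  obtain ⟨hEc, -, -⟩ := hE.elim
  have hint : ∀ c : ℂ, IntegrableOn (fun u : ℝ ↦ Complex.cos (c * u)) E := fun c ↦
    (by fun_prop : Continuous fun u : ℝ ↦ Complex.cos (c * u)).continuousOn.integrableOn_compact hEc
  unfold KEpm KE
  rw [one_mul, setIntegral_cexp_eq_cos hE hs, setIntegral_cexp_eq_cos hE hs,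
    ← integral_add (hint _) (hint _)]
  refine integral_congr_ae (Eventually.of_forall fun u ↦ ?_)
  simp only [sub_mul, add_mul, Complex.cos_sub, Complex.cos_add]
  ring

/-- For symmetric `E`: `K_E^−(x, y) = 2 ∫_E sin(xu) sin(yu) du`. [cite: Bombieri2000Weil, §9 (9.6)] -/
theorem KEpm_neg_one_eq {E : Set ℝ} (hE : IsFiniteUnionOfIntervals E) (hs : IsSymmetricSet E)
    (x y : ℂ) :
    KEpm (-1) E x y = ∫ u in E, 2 * (Complex.sin (x * u) * Complex.sin (y * u)) := by
  obtain ⟨hEc, -, -⟩ := hE.elim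
  have hint : ∀ c : ℂ, IntegrableOn (fun u : ℝ ↦ Complex.cos (c * u)) E := fun c ↦
    (by fun_prop : Continuous fun u : ℝ ↦ Complex.cos (c * u)).continuousOn.integrableOn_compact hEc
  unfold KEpm KE
  rw [neg_one_mul, ← sub_eq_add_neg, setIntegral_cexp_eq_cos hE hs, setIntegral_cexp_eq_cos hE hs,
    ← integral_sub (hint _) (hint _)]
  refine integral_congr_ae (Eventually.of_forall fun u ↦ ?_)
  simp only [sub_mul, add_mul, Complex.cos_sub, Complex.cos_add]
  ring

variable {V : Type} [Fintype V]

/-- Independence of exponential PAIRS `e^{∓ i w_v u}`: if the `w_v` are distinct and `w_v ≠ −w_{v'}`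
for all `v, v'`, a vanishing combination `Σ_v (x_v e^{−i w_v u} + y_v e^{i w_v u})` on an open interval
has `x = y = 0`. [folklore] -/
private theorem eq_zero_of_exp_pair_sum_eq_zero (w : V → ℂ) (hw : Function.Injective w)
    (hw' : ∀ v v', w v ≠ -w v') {a b : ℝ} (hab : a < b) (x y : V → ℂ)
    (h : ∀ u ∈ Ioo a b, ∑ v, (x v * cexp (-(I * w v) * u) + y v * cexp (-(I * -w v) * u)) = 0) :
    x = 0 ∧ y = 0 := by
  set W : V ⊕ V → ℂ := fun j ↦ Sum.elim w (fun v ↦ -w v) j with hW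
  set X : V ⊕ V → ℂ := fun j ↦ Sum.elim x y j with hX
  have hWinj : Function.Injective W := by
    rintro (v | v) (v' | v') hvv'
    · simp only [hW, Sum.elim_inl] at hvv'
      rw [hw hvv']
    · simp only [hW, Sum.elim_inl, Sum.elim_inr] at hvv'
      exact absurd hvv' (hw' v v')
    · simp only [hW, Sum.elim_inl, Sum.elim_inr] at hvv'
      exact absurd hvv'.symm (hw' v' v)
    · simp only [hW, Sum.elim_inr, neg_inj] at hvv'
      rw [hw hvv']
  have hX0 : X = 0 := by
    refine eq_zero_of_exp_sum_eq_zero W hWinj hab X fun u hu ↦ ?_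
    rw [Fintype.sum_sum_type]
    simp only [hX, hW, Sum.elim_inl, Sum.elim_inr]
    rw [← Finset.sum_add_distrib]
    exact h u hu
  constructor
  · funext v
    have := congrFun hX0 (Sum.inl v)
    simpa [hX] using this
  · funext v
    have := congrFun hX0 (Sum.inr v)
    simpa [hX] using this

/-- Independence of cosines with frequencies from a half-set (`w` injective, `w_v ≠ −w_{v'}`). [folklore] -/
private theorem eq_zero_of_cos_sum_eq_zero (w : V → ℂ) (hw : Function.Injective w)
    (hw' : ∀ v v', w v ≠ -w v') {a b : ℝ} (hab : a < b) (x : V → ℂ)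
    (h : ∀ u ∈ Ioo a b, ∑ v, x v * Complex.cos (w v * u) = 0) : x = 0 := by
  have key := eq_zero_of_exp_pair_sum_eq_zero w hw hw' hab (fun v ↦ x v / 2) (fun v ↦ x v / 2)
    fun u hu ↦ by
      rw [← h u hu]
      refine Finset.sum_congr rfl fun v _ ↦ ?_
      rw [Complex.cos]
      ring_nf
  funext v
  have := congrFun key.1 v
  simpa using this

/-- Independence of sines with frequencies from a half-set (`w` injective, `w_v ≠ −w_{v'}`). [folklore] -/
private theorem eq_zero_of_sin_sum_eq_zero (w : V → ℂ) (hw : Function.Injective w)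
    (hw' : ∀ v v', w v ≠ -w v') {a b : ℝ} (hab : a < b) (x : V → ℂ)
    (h : ∀ u ∈ Ioo a b, ∑ v, x v * Complex.sin (w v * u) = 0) : x = 0 := by
  have key := eq_zero_of_exp_pair_sum_eq_zero w hw hw' hab (fun v ↦ x v * I / 2)
    (fun v ↦ -(x v * I / 2)) fun u hu ↦ by
      rw [← h u hu]
      refine Finset.sum_congr rfl fun v _ ↦ ?_
      rw [Complex.sin]
      ring_nf
  funext v
  have := congrFun key.1 v
  simpa [I_ne_zero] using this

end Symmetric

/-! ## §G Theorem 9, second part: the sectors `𝒦_E^±(Γ)` for symmetric `E` -/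

section Sectors

open MeasureTheory Set

/-- Two elements of Bombieri's half-plane set `Γ₀` are never opposite. [folklore] -/
private theorem InGammaZero.ne_neg {z z' : ℂ} (hz : InGammaZero z) (hz' : InGammaZero z') : z ≠ -z' := by
  intro h
  have hre : z.re = -z'.re := by rw [h, Complex.neg_re]
  have him : z.im = -z'.im := by rw [h, Complex.neg_im]
  unfold InGammaZero at hz hz'
  rcases hz with h1 | ⟨h1, h2⟩ <;> rcases hz' with h1' | ⟨h1', h2'⟩ <;> linarith

open scoped Classical in
/-- **Theorem 9, second part** (§9): for symmetric `E` (and `Γ` closed under conjugation with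
multiplicity), the negative eigenvalues of `𝒦_E^+(Γ)` (resp. `𝒦_E^−(Γ)`) are counted by the distinct
conjugate pairs with `Re γ > 0` (resp. `Re γ ≥ 0`). (Gram factorisations
`𝒦_E^+ = P_τ · [2∫_E cos cos]`, `𝒦_E^− = S P_τ · [2∫_E sin sin]` on the distinct values in `Γ₀`, with
`τ` = conjugation on `Re > 0` and the identity on `iℝ`, `S = −1` exactly on `iℝ`.) [cite: Bombieri2000Weil, §9 Theorem 9] -/
theorem negEigenvalueCount_KMatPM {E : Set ℝ} (hE : IsFiniteUnionOfIntervals E)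
    (hs : IsSymmetricSet E) {ι : Type} [Fintype ι] [DecidableEq ι] (γ : ι → ℂ)
    (hc : FamilyInvariant γ (starRingEnd ℂ)) :
    negEigenvalueCount (KMatPM 1 E γ) = conjPairCountRe γ (fun r ↦ 0 < r) ∧
      negEigenvalueCount (KMatPM (-1) E γ) = conjPairCountRe γ (fun r ↦ 0 ≤ r) := by
  -- values in `Γ₀` and the involution `τ`
  set S : Finset ℂ := univ.image γ with hS
  set S₀ : Finset ℂ := S.filter InGammaZero with hS₀
  have hmemS : ∀ z ∈ S, conj z ∈ S := by
    intro z hz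
    obtain ⟨i, -, rfl⟩ := Finset.mem_image.mp hz
    obtain ⟨σ, hσ⟩ := hc
    exact Finset.mem_image.mpr ⟨σ i, Finset.mem_univ _, hσ i⟩
  have hG₀ : ∀ v : {z // z ∈ S₀}, InGammaZero v.1 := fun v ↦ (Finset.mem_filter.mp v.2).2
  set cz : ℂ → ℂ := fun z ↦ if 0 < z.re then conj z else z with hcz
  have hczS₀ : ∀ z ∈ S₀, cz z ∈ S₀ := by
    intro z hz
    obtain ⟨hzS, hz0⟩ := Finset.mem_filter.mp hz
    by_cases h : 0 < z.re
    · rw [hcz]; simp only [if_pos h]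
      exact Finset.mem_filter.mpr ⟨hmemS z hzS, Or.inl (by rwa [Complex.conj_re])⟩
    · rw [hcz]; simp only [if_neg h]; exact hz
  have hczinv : ∀ z, cz (cz z) = z := by
    intro z
    by_cases h : 0 < z.re
    · have h' : 0 < (conj z).re := by rwa [Complex.conj_re]
      simp only [hcz, if_pos h, if_pos h', Complex.conj_conj]
    · simp only [hcz, if_neg h]
  set τ : {z // z ∈ S₀} → {z // z ∈ S₀} := fun v ↦ ⟨cz v.1, hczS₀ v.1 v.2⟩ with hτ
  have hτv : ∀ v, (τ v).1 = cz v.1 := fun v ↦ rfl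
  have hτinv : Function.Involutive τ := fun v ↦ Subtype.ext (by rw [hτv, hτv, hczinv])
  -- real part zero in the second case
  have hre0 : ∀ v : {z // z ∈ S₀}, ¬ 0 < v.1.re → v.1.re = 0 := by
    intro v h
    rcases hG₀ v with h1 | ⟨h1, -⟩
    · exact absurd h1 h
    · exact h1
  have hconjτ : ∀ v : {z // z ∈ S₀}, conj (τ v).1 = if 0 < v.1.re then v.1 else -v.1 := by
    intro v
    rw [hτv]
    by_cases h : 0 < v.1.re
    · simp only [hcz, if_pos h, Complex.conj_conj]
    · simp only [hcz, if_neg h]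
      apply Complex.ext
      · rw [Complex.conj_re, Complex.neg_re, hre0 v h, neg_zero]
      · rw [Complex.conj_im, Complex.neg_im]
  -- slots in `Γ₀` and their values
  set val : {i : ι // InGammaZero (γ i)} → {z // z ∈ S₀} := fun i ↦
    ⟨γ i.1, Finset.mem_filter.mpr ⟨Finset.mem_image_of_mem γ (Finset.mem_univ _), i.2⟩⟩ with hval
  have hsurj : Function.Surjective val := by
    rintro ⟨z, hz⟩
    obtain ⟨hzS, hz0⟩ := Finset.mem_filter.mp hz
    obtain ⟨i, -, rfl⟩ := Finset.mem_image.mp hzS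
    exact ⟨⟨i, hz0⟩, rfl⟩
  have hfib : ∀ v : {z // z ∈ S₀},
      (univ.filter fun i ↦ val i = v).card = (univ.filter fun i ↦ γ i = v.1).card := by
    intro v
    rw [← Fintype.card_subtype, ← Fintype.card_subtype]
    refine Fintype.card_congr ⟨fun i ↦ ⟨i.1.1, congrArg Subtype.val i.2⟩,
      fun i ↦ ⟨⟨i.1, by rw [i.2]; exact hG₀ v⟩, Subtype.ext i.2⟩, fun i ↦ rfl, fun i ↦ rfl⟩
  have hmultτ : ∀ v : {z // z ∈ S₀},
      (univ.filter fun i ↦ val i = v).card = (univ.filter fun i ↦ val i = τ v).card := by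
    intro v
    rw [hfib, hfib, hτv]
    by_cases h : 0 < v.1.re
    · simp only [hcz, if_pos h]
      exact card_fiber_conj γ hc v.1
    · simp only [hcz, if_neg h]
  have hw' : ∀ v v' : {z // z ∈ S₀}, v.1 ≠ -v'.1 := fun v v' ↦ (hG₀ v).ne_neg (hG₀ v')
  -- signs
  set sg : {z // z ∈ S₀} → ℂ := fun v ↦ if 0 < v.1.re then 1 else -1 with hsg
  have hsg1 : ∀ v, sg v = 1 ∨ sg v = -1 := fun v ↦ by
    by_cases h : 0 < v.1.re
    · exact Or.inl (if_pos h)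
    · exact Or.inr (if_neg h)
  have hsgτ : ∀ v, sg (τ v) = sg v := by
    intro v
    have : (τ v).1.re = v.1.re := by
      rw [hτv]
      by_cases h : 0 < v.1.re
      · simp only [hcz, if_pos h, Complex.conj_re]
      · simp only [hcz, if_neg h]
    simp only [hsg, this]
  have hone1 : ∀ v : {z // z ∈ S₀}, (fun _ ↦ (1 : ℂ)) v = 1 ∨ (fun _ ↦ (1 : ℂ)) v = -1 :=
    fun v ↦ Or.inl rfl
  -- the counting identities, pointwise on `V`
  have hfixiff : ∀ v : {z // z ∈ S₀}, τ v = v ↔ (0 < v.1.re → v.1.im = 0) := by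
    intro v
    rw [Subtype.ext_iff, hτv]
    by_cases h : 0 < v.1.re
    · simp only [hcz, if_pos h, Complex.conj_eq_iff_im, h, forall_true_left]
    · simp only [hcz, if_neg h, h, IsEmpty.forall_iff]
  have hB : (univ.filter fun v : {z // z ∈ S₀} ↦ 0 < v.1.re ∧ v.1.im < 0).card =
      (univ.filter fun v : {z // z ∈ S₀} ↦ 0 < v.1.re ∧ 0 < v.1.im).card := by
    refine Finset.card_bij' (fun v _ ↦ τ v) (fun v _ ↦ τ v) (fun v hv ↦ ?_) (fun v hv ↦ ?_)
      (fun v _ ↦ hτinv v) (fun v _ ↦ hτinv v)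
    · rw [Finset.mem_filter] at hv ⊢
      refine ⟨Finset.mem_univ _, ?_⟩
      rw [hτv]
      simp only [hcz, if_pos hv.2.1, Complex.conj_re, Complex.conj_im]
      exact ⟨hv.2.1, by linarith [hv.2.2]⟩
    · rw [Finset.mem_filter] at hv ⊢
      refine ⟨Finset.mem_univ _, ?_⟩
      rw [hτv]
      simp only [hcz, if_pos hv.2.1, Complex.conj_re, Complex.conj_im]
      exact ⟨hv.2.1, by linarith [hv.2.2]⟩
  have hcount : ∀ p : ℂ → Prop, (∀ z, p z → InGammaZero z) →
      (univ.filter fun v : {z // z ∈ S₀} ↦ p v.1).card = (S.filter p).card := by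
    intro p hp
    rw [← Fintype.card_subtype, ← Fintype.card_coe (S.filter p)]
    refine Fintype.card_congr ⟨fun v ↦ ⟨v.1.1, Finset.mem_filter.mpr
        ⟨(Finset.mem_filter.mp v.1.2).1, v.2⟩⟩,
      fun z ↦ ⟨⟨z.1, Finset.mem_filter.mpr ⟨(Finset.mem_filter.mp z.2).1,
        hp z.1 (Finset.mem_filter.mp z.2).2⟩⟩, (Finset.mem_filter.mp z.2).2⟩,
      fun v ↦ rfl, fun z ↦ rfl⟩
  obtain ⟨hEc, -, -⟩ := hE.elim
  constructor
  · ------------------------------------------------------------------ even sector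
    set φ : {z // z ∈ S₀} → ℝ → ℂ := fun v u ↦ (Real.sqrt 2 : ℂ) * Complex.cos (v.1 * u) with hφ
    set G : Matrix {z // z ∈ S₀} {z // z ∈ S₀} ℂ :=
      Matrix.of fun a b ↦ ∫ u in E, conj (φ a u) * φ b u with hGdef
    set Q : Matrix {z // z ∈ S₀} {z // z ∈ S₀} ℂ :=
      Matrix.of fun v v' ↦ if v' = τ v then (1 : ℂ) else 0 with hQ
    have hGpos : G.PosDef := by
      refine posDef_gram hE φ (fun v ↦ by fun_prop) fun a b hab _ x hx ↦ ?_
      have key := eq_zero_of_cos_sum_eq_zero (fun v : {z // z ∈ S₀} ↦ v.1) Subtype.val_injective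
        hw' hab (fun v ↦ x v * (Real.sqrt 2 : ℂ)) fun u hu ↦ by
          rw [← hx u hu]
          refine Finset.sum_congr rfl fun v _ ↦ ?_
          simp only [hφ]
          ring
      funext v
      have h2 : (Real.sqrt 2 : ℂ) ≠ 0 := by exact_mod_cast (Real.sqrt_pos.mpr two_pos).ne'
      have := congrFun key v
      simpa [h2] using this
    have hQh : Q.IsHermitian := signedPerm_isHermitian hτinv hone1 (fun _ ↦ rfl)
    have hQ1 : Q * Q = 1 := signedPerm_mul_self hτinv hone1 (fun _ ↦ rfl)
    have hK : KMatPM 1 E γ = (Q * G).submatrix val val := by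
      ext i j
      rw [hQ, signedPerm_mul, Matrix.submatrix_apply, Matrix.of_apply, one_mul, KMatPM,
        Matrix.of_apply, KEpm_one_eq hE hs, hGdef, Matrix.of_apply]
      refine integral_congr_ae (Filter.Eventually.of_forall fun u ↦ ?_)
      simp only [hφ, map_mul, Complex.conj_ofReal, ← Complex.cos_conj, Complex.conj_ofReal,
        hconjτ]
      have h22 : (Real.sqrt 2 : ℂ) * (Real.sqrt 2 : ℂ) = 2 := by
        rw [← Complex.ofReal_mul, Real.mul_self_sqrt zero_le_two]; norm_num
      by_cases h : 0 < (val i).1.re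
      · rw [if_pos h]
        linear_combination (-(Complex.cos ((val i).1 * u) * Complex.cos ((val j).1 * u))) * h22
      · rw [if_neg h, show -((val i).1 : ℂ) * (u : ℂ) = -(((val i).1 : ℂ) * u) by ring,
          Complex.cos_neg]
        linear_combination (-(Complex.cos ((val i).1 * u) * Complex.cos ((val j).1 * u))) * h22
    have hmult : ∀ v w, Q v w ≠ 0 →
        (univ.filter fun i ↦ val i = v).card = (univ.filter fun i ↦ val i = w).card := by
      intro v w hvw
      rw [signedPerm_apply_ne_zero hvw]
      exact hmultτ v
    have key := two_mul_negEigenvalueCount_submatrix hQh hQ1 hGpos val hsurj hmult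
    rw [← hK, hQ, signedPerm_trace, Finset.sum_const, nsmul_eq_mul, mul_one] at key
    -- `card V − #fixed = 2 #{Re > 0, Im > 0}`
    have hpt : ∀ v : {z // z ∈ S₀}, (1 : ℝ) - (if τ v = v then 1 else 0) =
        (if 0 < v.1.re ∧ 0 < v.1.im then 1 else 0) + (if 0 < v.1.re ∧ v.1.im < 0 then 1 else 0) := by
      intro v
      by_cases h : 0 < v.1.re
      · rcases lt_trichotomy 0 v.1.im with him | him | him
        · have hnf : ¬ τ v = v := fun hf ↦ him.ne' ((hfixiff v).mp hf h)
          rw [if_neg hnf, if_pos ⟨h, him⟩, if_neg (fun h' ↦ by linarith [h'.2])]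
          norm_num
        · have hf : τ v = v := (hfixiff v).mpr (fun _ ↦ him.symm)
          rw [if_pos hf, if_neg (fun h' ↦ by linarith [h'.2]), if_neg (fun h' ↦ by linarith [h'.2])]
          norm_num
        · have hnf : ¬ τ v = v := fun hf ↦ him.ne ((hfixiff v).mp hf h)
          rw [if_neg hnf, if_neg (fun h' ↦ by linarith [h'.2]), if_pos ⟨h, him⟩]
          norm_num
      · have hf : τ v = v := (hfixiff v).mpr (fun h' ↦ absurd h' h)
        rw [if_pos hf, if_neg (fun h' ↦ h h'.1), if_neg (fun h' ↦ h h'.1)]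
        norm_num
    have hsumpt := Finset.sum_congr rfl fun v (_ : v ∈ (univ : Finset {z // z ∈ S₀})) ↦ hpt v
    rw [Finset.sum_sub_distrib, Finset.sum_add_distrib, Finset.sum_const, Finset.card_univ,
      nsmul_eq_mul, mul_one, Finset.sum_boole, Finset.sum_boole, Finset.sum_boole, hB] at hsumpt
    have hre : (↑(univ.filter fun v : {z // z ∈ S₀} ↦ τ v = v).card : ℂ).re =
        ((univ.filter fun v : {z // z ∈ S₀} ↦ τ v = v).card : ℝ) := by norm_cast
    rw [hre] at key
    have htarget : (univ.filter fun v : {z // z ∈ S₀} ↦ 0 < v.1.re ∧ 0 < v.1.im).card =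
        conjPairCountRe γ (fun r ↦ 0 < r) := by
      unfold conjPairCountRe
      rw [← hS]
      have e1 : (univ.filter fun v : {z // z ∈ S₀} ↦ 0 < v.1.re ∧ 0 < v.1.im) =
          univ.filter fun v : {z // z ∈ S₀} ↦ 0 < v.1.im ∧ 0 < v.1.re :=
        Finset.filter_congr fun v _ ↦ and_comm
      rw [e1]
      convert hcount (fun z ↦ 0 < z.im ∧ 0 < z.re) fun z hz ↦ Or.inl hz.2 using 3
    push_cast at hsumpt
    have : (negEigenvalueCount (KMatPM 1 E γ) : ℝ) = conjPairCountRe γ (fun r ↦ 0 < r) := by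
      rw [← htarget]; linarith
    exact_mod_cast this
  · ------------------------------------------------------------------ odd sector
    set φ : {z // z ∈ S₀} → ℝ → ℂ := fun v u ↦ (Real.sqrt 2 : ℂ) * Complex.sin (v.1 * u) with hφ
    set G : Matrix {z // z ∈ S₀} {z // z ∈ S₀} ℂ :=
      Matrix.of fun a b ↦ ∫ u in E, conj (φ a u) * φ b u with hGdef
    set Q : Matrix {z // z ∈ S₀} {z // z ∈ S₀} ℂ :=
      Matrix.of fun v v' ↦ if v' = τ v then sg v else 0 with hQ
    have hGpos : G.PosDef := by
      refine posDef_gram hE φ (fun v ↦ by fun_prop) fun a b hab _ x hx ↦ ?_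
      have key := eq_zero_of_sin_sum_eq_zero (fun v : {z // z ∈ S₀} ↦ v.1) Subtype.val_injective
        hw' hab (fun v ↦ x v * (Real.sqrt 2 : ℂ)) fun u hu ↦ by
          rw [← hx u hu]
          refine Finset.sum_congr rfl fun v _ ↦ ?_
          simp only [hφ]
          ring
      funext v
      have h2 : (Real.sqrt 2 : ℂ) ≠ 0 := by exact_mod_cast (Real.sqrt_pos.mpr two_pos).ne'
      have := congrFun key v
      simpa [h2] using this
    have hQh : Q.IsHermitian := signedPerm_isHermitian hτinv hsg1 hsgτ
    have hQ1 : Q * Q = 1 := signedPerm_mul_self hτinv hsg1 hsgτ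
    have hK : KMatPM (-1) E γ = (Q * G).submatrix val val := by
      ext i j
      rw [hQ, signedPerm_mul, Matrix.submatrix_apply, Matrix.of_apply, KMatPM,
        Matrix.of_apply, KEpm_neg_one_eq hE hs, hGdef, Matrix.of_apply, ← integral_const_mul]
      refine integral_congr_ae (Filter.Eventually.of_forall fun u ↦ ?_)
      simp only [hφ, hsg, map_mul, Complex.conj_ofReal, ← Complex.sin_conj, Complex.conj_ofReal,
        hconjτ]
      have h22 : (Real.sqrt 2 : ℂ) * (Real.sqrt 2 : ℂ) = 2 := by
        rw [← Complex.ofReal_mul, Real.mul_self_sqrt zero_le_two]; norm_num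
      by_cases h : 0 < (val i).1.re
      · simp only [if_pos h]
        linear_combination (-(Complex.sin ((val i).1 * u) * Complex.sin ((val j).1 * u))) * h22
      · simp only [if_neg h]
        rw [show -((val i).1 : ℂ) * (u : ℂ) = -(((val i).1 : ℂ) * u) by ring, Complex.sin_neg]
        linear_combination (-(Complex.sin ((val i).1 * u) * Complex.sin ((val j).1 * u))) * h22
    have hmult : ∀ v w, Q v w ≠ 0 →
        (univ.filter fun i ↦ val i = v).card = (univ.filter fun i ↦ val i = w).card := by
      intro v w hvw
      rw [signedPerm_apply_ne_zero hvw]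
      exact hmultτ v
    have key := two_mul_negEigenvalueCount_submatrix hQh hQ1 hGpos val hsurj hmult
    rw [← hK, hQ, signedPerm_trace] at key
    -- `card V − Σ_{fixed} sg = 2 #{Im > 0, Re ≥ 0}`
    have hpt : ∀ v : {z // z ∈ S₀}, (1 : ℝ) - (if τ v = v then (if 0 < v.1.re then 1 else -1) else 0) =
        (if 0 < v.1.re ∧ 0 < v.1.im then 1 else 0) + (if 0 < v.1.re ∧ v.1.im < 0 then 1 else 0) +
          2 * (if ¬ 0 < v.1.re then 1 else 0) := by
      intro v
      by_cases h : 0 < v.1.re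
      · rcases lt_trichotomy 0 v.1.im with him | him | him
        · have hnf : ¬ τ v = v := fun hf ↦ him.ne' ((hfixiff v).mp hf h)
          rw [if_neg hnf, if_pos ⟨h, him⟩, if_neg (fun h' ↦ by linarith [h'.2]),
            if_neg (not_not.mpr h)]
          norm_num
        · have hf : τ v = v := (hfixiff v).mpr (fun _ ↦ him.symm)
          rw [if_pos hf, if_pos h, if_neg (fun h' ↦ by linarith [h'.2]),
            if_neg (fun h' ↦ by linarith [h'.2]), if_neg (not_not.mpr h)]
          norm_num
        · have hnf : ¬ τ v = v := fun hf ↦ him.ne ((hfixiff v).mp hf h)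
          rw [if_neg hnf, if_neg (fun h' ↦ by linarith [h'.2]), if_pos ⟨h, him⟩,
            if_neg (not_not.mpr h)]
          norm_num
      · have hf : τ v = v := (hfixiff v).mpr (fun h' ↦ absurd h' h)
        rw [if_pos hf, if_neg h, if_neg (fun h' ↦ h h'.1), if_neg (fun h' ↦ h h'.1), if_pos h]
        norm_num
    have hpt2 : ∀ v : {z // z ∈ S₀}, (if 0 < v.1.im ∧ 0 ≤ v.1.re then (1 : ℝ) else 0) =
        (if 0 < v.1.re ∧ 0 < v.1.im then 1 else 0) + (if ¬ 0 < v.1.re then 1 else 0) := by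
      intro v
      by_cases h : 0 < v.1.re
      · rw [if_neg (not_not.mpr h)]
        by_cases him : 0 < v.1.im
        · rw [if_pos ⟨him, h.le⟩, if_pos ⟨h, him⟩]; norm_num
        · rw [if_neg (fun h' ↦ him h'.1), if_neg (fun h' ↦ him h'.2)]; norm_num
      · have h0 := hre0 v h
        have him : 0 < v.1.im := by
          rcases hG₀ v with h1 | ⟨-, h2⟩
          · exact absurd h1 h
          · exact h2
        rw [if_pos ⟨him, h0.symm.le⟩, if_neg (fun h' ↦ h h'.1), if_pos h]
        norm_num
    have hsumpt := Finset.sum_congr rfl fun v (_ : v ∈ (univ : Finset {z // z ∈ S₀})) ↦ hpt v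
    have hsumpt2 := Finset.sum_congr rfl fun v (_ : v ∈ (univ : Finset {z // z ∈ S₀})) ↦ hpt2 v
    rw [Finset.sum_sub_distrib, Finset.sum_add_distrib, Finset.sum_add_distrib, Finset.sum_const,
      Finset.card_univ, nsmul_eq_mul, mul_one, ← Finset.mul_sum, Finset.sum_boole, Finset.sum_boole,
      Finset.sum_boole, hB] at hsumpt
    rw [Finset.sum_add_distrib, Finset.sum_boole, Finset.sum_boole, Finset.sum_boole] at hsumpt2
    have hre : (∑ v ∈ univ.filter (fun v : {z // z ∈ S₀} ↦ τ v = v), sg v).re =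
        ∑ v : {z // z ∈ S₀}, (if τ v = v then (if 0 < v.1.re then (1 : ℝ) else -1) else 0) := by
      rw [Finset.sum_filter, Complex.re_sum]
      refine Finset.sum_congr rfl fun v _ ↦ ?_
      simp only [hsg]
      split_ifs <;> simp
    rw [hre] at key
    have htarget : (univ.filter fun v : {z // z ∈ S₀} ↦ 0 < v.1.im ∧ 0 ≤ v.1.re).card =
        conjPairCountRe γ (fun r ↦ 0 ≤ r) := by
      unfold conjPairCountRe
      rw [← hS]
      convert hcount (fun z ↦ 0 < z.im ∧ 0 ≤ z.re) (fun z hz ↦ by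
        rcases hz.2.lt_or_eq with h | h
        · exact Or.inl h
        · exact Or.inr ⟨h.symm, hz.1⟩) using 3
    push_cast at hsumpt hsumpt2
    have : (negEigenvalueCount (KMatPM (-1) E γ) : ℝ) = conjPairCountRe γ (fun r ↦ 0 ≤ r) := by
      rw [← htarget]; linarith
    exact_mod_cast this

end Sectors


/-! ## §I Theorem 8: `ℋ(Γ; t)` is a Gram kernel (§8, (8.14)–(8.15)) -/

section TheoremEight

open MeasureTheory Set Filter
open scoped Topology

/-- `conj E(s) = E(s̄)`. [folklore] -/
private theorem conj_expDiff (t : ℝ) (s : ℂ) : conj (expDiff t s) = expDiff t (conj s) := by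
  simp only [expDiff, map_sub, ← Complex.exp_conj, map_neg, map_mul, Complex.conj_ofReal]

/-- `E(−s) = −E(s)`. [folklore] -/
private theorem expDiff_neg (t : ℝ) (s : ℂ) : expDiff t (-s) = -expDiff t s := by
  simp only [expDiff, neg_mul, neg_neg]
  ring

/-- `c ∫_{−t}^{t} e^{cu} du = e^{ct} − e^{−ct}` (also for `c = 0`). [folklore] -/
private theorem mul_integral_cexp (t : ℝ) (c : ℂ) :
    c * ∫ u in (-t)..t, cexp (c * u) = expDiff t c := by
  rcases eq_or_ne c 0 with rfl | hc
  · simp [expDiff]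
  · rw [integral_exp_mul_complex hc, mul_div_cancel₀ _ hc]
    simp only [expDiff, Complex.ofReal_neg, mul_neg]

/-- `e^{(a+b)r} = e^{ar} e^{br}`. [folklore] -/
private theorem cexp_add_mul (a b : ℂ) (r : ℝ) : cexp ((a + b) * r) = cexp (a * r) * cexp (b * r) := by
  rw [← Complex.exp_add]; ring_nf

/-- `e^{(a−b)r} = e^{ar} (e^{br})⁻¹`. [folklore] -/
private theorem cexp_sub_mul (a b : ℂ) (r : ℝ) : cexp ((a - b) * r) = cexp (a * r) * (cexp (b * r))⁻¹ := by
  rw [← Complex.exp_neg, ← Complex.exp_add]; ring_nf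

/-- `e^{−ar} = (e^{ar})⁻¹`. [folklore] -/
private theorem cexp_neg_mul' (a : ℂ) (r : ℝ) : cexp (-(a * r)) = (cexp (a * r))⁻¹ := by
  rw [Complex.exp_neg]

/-- The product identity `E(½−iy)E(½+ix) − E(½+iy)E(½−ix) = E(1)E(i(x−y))`. [folklore] -/
private theorem expDiff_prod_identity (t : ℝ) (X Y : ℂ) :
    expDiff t (1 / 2 - Y) * expDiff t (1 / 2 + X) - expDiff t (1 / 2 + Y) * expDiff t (1 / 2 - X) =
      expDiff t 1 * expDiff t (X - Y) := by
  have h1 : cexp (1 * (t : ℂ)) = cexp ((1 / 2 : ℂ) * t) * cexp ((1 / 2 : ℂ) * t) := by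
    rw [← Complex.exp_add]; ring_nf
  simp only [expDiff, cexp_neg_mul', cexp_add_mul, cexp_sub_mul, h1]
  have hP : cexp ((1 / 2 : ℂ) * t) ≠ 0 := Complex.exp_ne_zero _
  have hX : cexp (X * t) ≠ 0 := Complex.exp_ne_zero _
  have hY : cexp (Y * t) ≠ 0 := Complex.exp_ne_zero _
  field_simp
  ring


/-- **The Gram identity behind (8.14).** With `ψ_a = (e^{−iau} − A_a e^{u/2} − B_a e^{−u/2})/(2(¼ + a²))`
and `Dψ_a = (−ia e^{−iau} − ½A_a e^{u/2} + ½B_a e^{−u/2})/(¼ + a²)` (`A_a = E(½−ia)/E(1)`,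
`B_a = E(½+ia)/E(1)`, `E(s) = e^{st} − e^{−st}`), Bombieri's kernel is the Gram entry
`H(x, y, t) = ∫_{−t}^{t} conj(ψ_{x̄}) ψ_y + ∫_{−t}^{t} conj(Dψ_{x̄}) Dψ_y` (the form `¼∫|F|² + ∫|F'|²`
of (8.14) on `F = Z − Ae^{u/2} − Be^{−u/2}`, (8.15)). [cite: Bombieri2000Weil, §8 (8.14)–(8.15)] -/
private theorem H_eq_gram {t : ℝ} (ht : 0 < t) (ψ Dψ : ℂ → ℝ → ℂ)
    (hψ : ψ = fun (a : ℂ) (u : ℝ) ↦ (cexp (-(I * a) * u) - expDiff t (1 / 2 - I * a) / expDiff t 1 *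
        cexp ((1 / 2 : ℂ) * u) - expDiff t (1 / 2 + I * a) / expDiff t 1 * cexp (-(1 / 2 : ℂ) * u)) /
        (2 * (1 / 4 + a ^ 2)))
    (hDψ : Dψ = fun (a : ℂ) (u : ℝ) ↦ (-(I * a) * cexp (-(I * a) * u) -
        expDiff t (1 / 2 - I * a) / expDiff t 1 / 2 * cexp ((1 / 2 : ℂ) * u) +
        expDiff t (1 / 2 + I * a) / expDiff t 1 / 2 * cexp (-(1 / 2 : ℂ) * u)) / (1 / 4 + a ^ 2))
    {x y : ℂ} (hx : x ≠ I / 2 ∧ x ≠ -(I / 2)) (hy : y ≠ I / 2 ∧ y ≠ -(I / 2)) :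
    H t x y = (∫ u in Icc (-t) t, conj (ψ (conj x) u) * ψ y u) +
      ∫ u in Icc (-t) t, conj (Dψ (conj x) u) * Dψ y u := by
  -- non-vanishing denominators
  have hE1 : expDiff t 1 ≠ 0 := by
    unfold expDiff
    rw [sub_ne_zero, one_mul]
    intro h
    have h2 := congrArg Complex.re h
    rw [Complex.exp_ofReal_re, ← Complex.ofReal_neg, Complex.exp_ofReal_re] at h2
    have := Real.exp_injective h2
    linarith
  have hpx : (1 / 2 : ℂ) + I * x ≠ 0 := fun h ↦ hx.1 (by linear_combination (-I) * h + x * I_mul_I)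
  have hmx : (1 / 2 : ℂ) - I * x ≠ 0 := fun h ↦ hx.2 (by linear_combination I * h + x * I_mul_I)
  have hpy : (1 / 2 : ℂ) + I * y ≠ 0 := fun h ↦ hy.1 (by linear_combination (-I) * h + y * I_mul_I)
  have hmy : (1 / 2 : ℂ) - I * y ≠ 0 := fun h ↦ hy.2 (by linear_combination I * h + y * I_mul_I)
  have hdx' : (1 / 4 : ℂ) + x ^ 2 = (1 / 2 + I * x) * (1 / 2 - I * x) := by
    linear_combination x ^ 2 * I_mul_I
  have hdx : (1 / 4 : ℂ) + x ^ 2 ≠ 0 := by rw [hdx']; exact mul_ne_zero hpx hmx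
  have hdy : (1 / 4 : ℂ) + y ^ 2 ≠ 0 := by
    rw [show (1 / 4 : ℂ) + y ^ 2 = (1 / 2 + I * y) * (1 / 2 - I * y) by
      linear_combination y ^ 2 * I_mul_I]
    exact mul_ne_zero hpy hmy
  -- exponents and coefficients of the integrand
  set s : Fin 7 → ℂ := ![I * x - I * y, 1 / 2 + I * x, I * x - 1 / 2, 1 / 2 - I * y,
    -(1 / 2) - I * y, 1, -1] with hs
  set c : Fin 7 → ℂ := ![1 / 4 - I * x * (I * y),
    -(expDiff t (1 / 2 - I * y) / expDiff t 1 * (1 / 2 + I * x)) / 2,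
    -(expDiff t (1 / 2 + I * y) / expDiff t 1 * (1 / 2 - I * x)) / 2,
    -(expDiff t (1 / 2 + I * x) / expDiff t 1 * (1 / 2 - I * y)) / 2,
    -(expDiff t (1 / 2 - I * x) / expDiff t 1 * (1 / 2 + I * y)) / 2,
    expDiff t (1 / 2 + I * x) / expDiff t 1 * (expDiff t (1 / 2 - I * y) / expDiff t 1) / 2,
    expDiff t (1 / 2 - I * x) / expDiff t 1 * (expDiff t (1 / 2 + I * y) / expDiff t 1) / 2] with hc
  -- the integrand, pointwise
  have h1u : ∀ u : ℝ, cexp (1 * (u : ℂ)) = cexp ((1 / 2 : ℂ) * u) * cexp ((1 / 2 : ℂ) * u) := by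
    intro u; rw [← Complex.exp_add]; ring_nf
  have hpt : ∀ u : ℝ, conj (ψ (conj x) u) * ψ y u + conj (Dψ (conj x) u) * Dψ y u =
      (∑ k : Fin 7, c k * cexp (s k * u)) / ((1 / 4 + x ^ 2) * (1 / 4 + y ^ 2)) := by
    intro u
    have hp : cexp ((1 / 2 : ℂ) * u) ≠ 0 := Complex.exp_ne_zero _
    have hex : cexp (I * x * u) ≠ 0 := Complex.exp_ne_zero _
    have hey : cexp (I * y * u) ≠ 0 := Complex.exp_ne_zero _
    simp only [hψ, hDψ, map_sub, map_mul, map_div₀, map_inv₀, map_add, map_pow, map_neg, map_one,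
      map_ofNat, Complex.conj_conj, conj_expDiff, ← Complex.exp_conj, Complex.conj_ofReal,
      Complex.conj_I, neg_mul, neg_neg, inv_inv, ← sub_eq_add_neg, Fin.sum_univ_seven, hs, hc,
      Matrix.cons_val_zero, Matrix.cons_val_one, Matrix.cons_val, cexp_neg_mul', cexp_add_mul,
      cexp_sub_mul, h1u]
    field_simp
    ring
  -- closed forms of the exponential integrals
  have hI1 : (∫ u in (-t)..t, cexp ((1 / 2 + I * x) * u)) = expDiff t (1 / 2 + I * x) / (1 / 2 + I * x) := by
    rw [eq_div_iff hpx, mul_comm]; exact mul_integral_cexp t _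
  have hI2 : (∫ u in (-t)..t, cexp ((I * x - 1 / 2) * u)) = expDiff t (1 / 2 - I * x) / (1 / 2 - I * x) := by
    have h1 := mul_integral_cexp t (I * x - 1 / 2)
    have h2 : expDiff t (I * x - 1 / 2) = -expDiff t (1 / 2 - I * x) := by
      rw [← expDiff_neg]; congr 1; ring
    rw [eq_div_iff hmx]
    linear_combination -h1 - h2
  have hI3 : (∫ u in (-t)..t, cexp ((1 / 2 - I * y) * u)) = expDiff t (1 / 2 - I * y) / (1 / 2 - I * y) := by
    rw [eq_div_iff hmy, mul_comm]; exact mul_integral_cexp t _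
  have hI4 : (∫ u in (-t)..t, cexp ((-(1 / 2) - I * y) * u)) = expDiff t (1 / 2 + I * y) / (1 / 2 + I * y) := by
    have h1 := mul_integral_cexp t (-(1 / 2) - I * y)
    have h2 : expDiff t (-(1 / 2) - I * y) = -expDiff t (1 / 2 + I * y) := by
      rw [← expDiff_neg]; congr 1; ring
    rw [eq_div_iff hpy]
    linear_combination -h1 - h2
  have hI5 : (∫ u in (-t)..t, cexp (1 * (u : ℂ))) = expDiff t 1 := by
    have h1 := mul_integral_cexp t 1
    rwa [one_mul] at h1
  have hI6 : (∫ u in (-t)..t, cexp (-1 * (u : ℂ))) = expDiff t 1 := by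
    have h1 := mul_integral_cexp t (-1)
    rw [expDiff_neg] at h1
    linear_combination -h1
  have hJ : (∫ u in (-t)..t, cexp (I * x * u) * cexp (-(I * y * u))) =
      ∫ u in (-t)..t, cexp ((I * x - I * y) * u) := by
    refine intervalIntegral.integral_congr fun u _ ↦ ?_
    show cexp (I * x * u) * cexp (-(I * y * u)) = cexp ((I * x - I * y) * u)
    rw [← Complex.exp_add]; ring_nf
  -- integrability
  have hcont : ∀ a : ℂ, Continuous (ψ a) ∧ Continuous (Dψ a) := by
    intro a; rw [hψ, hDψ]; constructor <;> fun_prop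
  have hf : IntegrableOn (fun u ↦ conj (ψ (conj x) u) * ψ y u) (Icc (-t) t) :=
    (((hcont _).1.star).mul (hcont _).1).integrableOn_Icc
  have hg : IntegrableOn (fun u ↦ conj (Dψ (conj x) u) * Dψ y u) (Icc (-t) t) :=
    (((hcont _).2.star).mul (hcont _).2).integrableOn_Icc
  rw [← integral_add hf hg]
  simp only [hpt]
  rw [MeasureTheory.integral_div, integral_Icc_eq_integral_Ioc, ← intervalIntegral.integral_of_le (by linarith),
    intervalIntegral.integral_finsetSum (fun k _ ↦
      ((by fun_prop : Continuous fun u : ℝ ↦ c k * cexp (s k * u))).intervalIntegrable _ _)]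
  simp only [intervalIntegral.integral_const_mul, Fin.sum_univ_seven, hs, hc, Matrix.cons_val_zero,
    Matrix.cons_val_one, Matrix.cons_val]
  rw [hI1, hI2, hI3, hI4, hI5, hI6]
  unfold H
  rw [hJ, hdx']
  rcases eq_or_ne x y with rfl | hxy
  · set P := (1 / 2 : ℂ) + I * x with hP
    set M := (1 / 2 : ℂ) - I * x with hM
    set Dy := (1 / 4 : ℂ) + x ^ 2 with hDy
    set E1 := expDiff t 1 with hE1'
    field_simp
    simp only [hP, hM]
    ring
  · have hs0 : I * x - I * y ≠ 0 := by
      rw [← mul_sub]; exact mul_ne_zero I_ne_zero (sub_ne_zero.mpr hxy)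
    have hI0 : (∫ u in (-t)..t, cexp ((I * x - I * y) * u)) =
        (expDiff t (1 / 2 - I * y) * expDiff t (1 / 2 + I * x) -
          expDiff t (1 / 2 + I * y) * expDiff t (1 / 2 - I * x)) / (expDiff t 1 * (I * x - I * y)) := by
      have h1 := mul_integral_cexp t (I * x - I * y)
      have h2 := expDiff_prod_identity t (I * x) (I * y)
      rw [eq_div_iff (mul_ne_zero hE1 hs0)]
      linear_combination expDiff t 1 * h1 - h2
    rw [hI0]
    set P := (1 / 2 : ℂ) + I * x with hP
    set M := (1 / 2 : ℂ) - I * x with hM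
    set Py := (1 / 2 : ℂ) + I * y with hPy
    set My := (1 / 2 : ℂ) - I * y with hMy
    set Dy := (1 / 4 : ℂ) + y ^ 2 with hDy
    set D0 := I * x - I * y with hD0
    set E1 := expDiff t 1 with hE1'
    field_simp
    simp only [hP, hM, hPy, hMy, hD0]
    ring

/-- Gram matrices `[∫_E conj(φ_a) φ_b]` of continuous families are positive semidefinite (the form is
`∫_E ‖Σ x_v φ_v‖² ≥ 0`). [folklore] -/
private theorem posSemidef_gram {V : Type} [Fintype V] {E : Set ℝ} (hE : IsFiniteUnionOfIntervals E)
    (φ : V → ℝ → ℂ) (hφ : ∀ v, Continuous (φ v)) :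
    (Matrix.of fun a b : V ↦ ∫ u in E, conj (φ a u) * φ b u).PosSemidef := by
  obtain ⟨hEc, hEm, -⟩ := hE.elim
  have hint : ∀ a b : V, IntegrableOn (fun u ↦ conj (φ a u) * φ b u) E :=
    fun a b ↦ (((hφ a).star).mul (hφ b)).continuousOn.integrableOn_compact hEc
  refine Matrix.PosSemidef.of_dotProduct_mulVec_nonneg ?_ fun x ↦ ?_
  · refine Matrix.IsHermitian.ext fun i j ↦ ?_
    rw [Matrix.of_apply, Matrix.of_apply, Complex.star_def, ← integral_conj]
    refine integral_congr_ae (Eventually.of_forall fun u ↦ ?_)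
    simp only [map_mul, starRingEnd_self_apply, mul_comm]
  · set h : ℝ → ℂ := fun u ↦ ∑ v, x v * φ v u with hh
    have h1 : ∀ u, (∑ a, ∑ b, star (x a) * (conj (φ a u) * φ b u) * x b) =
        ((‖h u‖ ^ 2 : ℝ) : ℂ) := by
      intro u
      rw [Complex.ofReal_pow, ← Complex.conj_mul', hh]
      simp only [map_sum, map_mul]
      rw [Finset.sum_mul]
      refine Finset.sum_congr rfl fun a _ ↦ ?_
      rw [Finset.mul_sum]
      refine Finset.sum_congr rfl fun b _ ↦ ?_
      rw [Complex.star_def]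
      ring
    have hq : star x ⬝ᵥ ((Matrix.of fun a b : V ↦ ∫ u in E, conj (φ a u) * φ b u) *ᵥ x) =
        ((∫ u in E, ‖h u‖ ^ 2 : ℝ) : ℂ) := by
      rw [← integral_complex_ofReal]
      simp_rw [← h1]
      rw [integral_finsetSum _ fun a _ ↦ ?_]
      · simp only [dotProduct, Matrix.mulVec, Matrix.of_apply, Pi.star_apply, Finset.mul_sum]
        refine Finset.sum_congr rfl fun a _ ↦ ?_
        rw [integral_finsetSum _ fun b _ ↦ ?_]
        · refine Finset.sum_congr rfl fun b _ ↦ ?_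
          rw [← integral_mul_const, ← integral_const_mul]
          refine integral_congr_ae (Eventually.of_forall fun u ↦ ?_)
          simp only [mul_assoc]
        · exact ((hint a b).const_mul _).mul_const _
      · exact integrable_finsetSum _ fun b _ ↦ ((hint a b).const_mul _).mul_const _
    rw [hq, Complex.zero_le_real]
    exact setIntegral_nonneg hEm fun u _ ↦ by positivity

/-- The functions `ψ_v = (e^{−ivu} − A_v e^{u/2} − B_v e^{−u/2})/(2(¼ + v²))`, for distinct `v` avoiding
`±i/2`, are linearly independent on every open interval: they are exponential sums over the distinct
exponents `{−iv} ∪ {±½}` (proof of Lemma 10: "the functions `e^{u/2}`, `e^{−u/2}` and `e^{−iγu}` are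
linearly independent over any finite interval"). [cite: Bombieri2000Weil, §8 proof of Lemma 10] -/
private theorem eq_zero_of_psi_sum_eq_zero {V : Type} [Fintype V] (t : ℝ) (w : V → ℂ)
    (hw : Function.Injective w) (hw' : ∀ v, w v ≠ I / 2 ∧ w v ≠ -(I / 2)) (ψ : ℂ → ℝ → ℂ)
    (hψ : ψ = fun (a : ℂ) (u : ℝ) ↦ (cexp (-(I * a) * u) - expDiff t (1 / 2 - I * a) / expDiff t 1 *
        cexp ((1 / 2 : ℂ) * u) - expDiff t (1 / 2 + I * a) / expDiff t 1 * cexp (-(1 / 2 : ℂ) * u)) /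
        (2 * (1 / 4 + a ^ 2)))
    {a b : ℝ} (hab : a < b) (x : V → ℂ) (h : ∀ u ∈ Ioo a b, ∑ v, x v * ψ (w v) u = 0) : x = 0 := by
  -- exponents and coefficients on `V ⊕ Bool` (`true ↦ e^{u/2}`, `false ↦ e^{−u/2}`)
  set W : V ⊕ Bool → ℂ := fun j ↦ Sum.elim w (fun b ↦ if b then I / 2 else -(I / 2)) j with hW
  set X : V ⊕ Bool → ℂ := fun j ↦ Sum.elim (fun v ↦ x v / (2 * (1 / 4 + w v ^ 2)))
    (fun b ↦ if b then -∑ v, x v * (expDiff t (1 / 2 - I * w v) / expDiff t 1) / (2 * (1 / 4 + w v ^ 2))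
      else -∑ v, x v * (expDiff t (1 / 2 + I * w v) / expDiff t 1) / (2 * (1 / 4 + w v ^ 2))) j with hX
  have hI2 : (I / 2 : ℂ) ≠ -(I / 2) := by
    intro h0
    have : (I : ℂ) = 0 := by linear_combination h0
    exact I_ne_zero this
  have hWinj : Function.Injective W := by
    rintro (v | b) (v' | b') hvv'
    · simp only [hW, Sum.elim_inl] at hvv'
      rw [hw hvv']
    · simp only [hW, Sum.elim_inl, Sum.elim_inr] at hvv'
      cases b'
      · exact absurd (by simpa using hvv') (hw' v).2
      · exact absurd (by simpa using hvv') (hw' v).1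
    · simp only [hW, Sum.elim_inl, Sum.elim_inr] at hvv'
      cases b
      · exact absurd (by simpa using hvv'.symm) (hw' v').2
      · exact absurd (by simpa using hvv'.symm) (hw' v').1
    · cases b <;> cases b' <;> simp only [hW, Sum.elim_inr, if_true, if_false, Bool.false_eq_true]
        at hvv' ⊢
      · exact absurd hvv'.symm hI2
      · exact absurd hvv' hI2
  have hX0 : X = 0 := by
    refine eq_zero_of_exp_sum_eq_zero W hWinj hab X fun u hu ↦ ?_
    have e1 : cexp (-(I * (I / 2)) * (u : ℂ)) = cexp ((1 / 2 : ℂ) * u) := by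
      congr 1; linear_combination (-(u : ℂ) / 2) * I_mul_I
    have e2 : cexp (-(I * -(I / 2)) * (u : ℂ)) = cexp (-(1 / 2 : ℂ) * u) := by
      congr 1; linear_combination ((u : ℂ) / 2) * I_mul_I
    have key : ∀ v, x v * ψ (w v) u =
        x v / (2 * (1 / 4 + w v ^ 2)) * cexp (-(I * w v) * u) -
          x v * (expDiff t (1 / 2 - I * w v) / expDiff t 1) / (2 * (1 / 4 + w v ^ 2)) *
            cexp ((1 / 2 : ℂ) * u) -
          x v * (expDiff t (1 / 2 + I * w v) / expDiff t 1) / (2 * (1 / 4 + w v ^ 2)) *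
            cexp (-(1 / 2 : ℂ) * u) := by
      intro v; rw [hψ]; ring
    have h' := h u hu
    rw [Finset.sum_congr rfl fun v _ ↦ key v, Finset.sum_sub_distrib, Finset.sum_sub_distrib,
      ← Finset.sum_mul, ← Finset.sum_mul] at h'
    rw [Fintype.sum_sum_type, Fintype.sum_bool]
    simp only [hX, hW, Sum.elim_inl, Sum.elim_inr, if_true, if_false, Bool.false_eq_true, e1, e2]
    linear_combination h'
  have hd : ∀ v, (1 / 4 : ℂ) + w v ^ 2 ≠ 0 := fun v h0 ↦ by
    have hfac : (w v - I / 2) * (w v + I / 2) = 0 := by linear_combination h0 - (1 / 4 : ℂ) * I_mul_I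
    rcases mul_eq_zero.mp hfac with h1 | h1
    · exact (hw' v).1 (sub_eq_zero.mp h1)
    · exact (hw' v).2 (eq_neg_of_add_eq_zero_left h1)
  funext v
  have hv := congrFun hX0 (Sum.inl v)
  simp only [hX, Sum.elim_inl, Pi.zero_apply, div_eq_zero_iff, mul_eq_zero, OfNat.ofNat_ne_zero,
    false_or] at hv
  rcases hv with hv | hv
  · exact hv
  · exact absurd hv (hd v)

open scoped Classical in
/-- **Bombieri 2000, Theorem 8** (§8): for `t > 0` and a finite multiset `Γ` closed under conjugation
with multiplicity and avoiding `±i/2` (the removable singularities of the printed kernel), the matrix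
`ℋ(Γ; t) = [H(γ, γ', t)]` has exactly as many negative eigenvalues as there are distinct conjugate
pairs `(γ, γ̄)` in `Γ`. Proof by the Gram structure of (8.14)–(8.15):
`H(x, y, t) = ⟨ψ_{x̄}, ψ_y⟩` for the form `¼∫_{−t}^{t} F̄G + ∫_{−t}^{t} F̄'G'` and
`ψ_γ = (e^{−iγu} − A_γ e^{u/2} − B_γ e^{−u/2})/(¼ + γ²)` (the projection `F = Z − Ae^{u/2} − Be^{−u/2}` of
(8.15); positive definite by the independence of the exponentials noted in the proof of Lemma 10),
followed by Sylvester's law of inertia (the reduction theorem of §B) — replacing the deformation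
argument of the printed proof. The symmetry `γ ↦ −γ` of §8 is not needed. [cite: Bombieri2000Weil, §8 Theorem 8] -/
theorem negEigenvalueCount_HMat {t : ℝ} (ht : 0 < t) {ι : Type} [Fintype ι] [DecidableEq ι]
    (γ : ι → ℂ) (hc : FamilyInvariant γ (starRingEnd ℂ)) (hγ : ∀ i, γ i ≠ I / 2 ∧ γ i ≠ -(I / 2)) :
    negEigenvalueCount (HMat t γ) = conjPairCount γ := by
  -- the Gram family of (8.15), introduced as opaque functions with defining equations
  obtain ⟨ψ, hψ⟩ : ∃ ψ : ℂ → ℝ → ℂ, ψ = fun (a : ℂ) (u : ℝ) ↦ (cexp (-(I * a) * u) -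
      expDiff t (1 / 2 - I * a) / expDiff t 1 * cexp ((1 / 2 : ℂ) * u) -
      expDiff t (1 / 2 + I * a) / expDiff t 1 * cexp (-(1 / 2 : ℂ) * u)) / (2 * (1 / 4 + a ^ 2)) :=
    ⟨_, rfl⟩
  obtain ⟨Dψ, hDψ⟩ : ∃ Dψ : ℂ → ℝ → ℂ, Dψ = fun (a : ℂ) (u : ℝ) ↦ (-(I * a) * cexp (-(I * a) * u) -
      expDiff t (1 / 2 - I * a) / expDiff t 1 / 2 * cexp ((1 / 2 : ℂ) * u) +
      expDiff t (1 / 2 + I * a) / expDiff t 1 / 2 * cexp (-(1 / 2 : ℂ) * u)) / (1 / 4 + a ^ 2) :=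
    ⟨_, rfl⟩
  have hE : IsFiniteUnionOfIntervals (Icc (-t) t) := by
    refine ⟨{(-t, t)}, Finset.singleton_nonempty _, ?_, ?_⟩
    · intro p hp
      rw [Finset.mem_singleton] at hp
      subst hp
      show -t < t
      linarith
    · simp
  have hcont : ∀ a : ℂ, Continuous (ψ a) ∧ Continuous (Dψ a) := by
    intro a; rw [hψ, hDψ]; constructor <;> fun_prop
  have hval : ∀ v : {z // z ∈ (univ : Finset ι).image γ}, v.1 ≠ I / 2 ∧ v.1 ≠ -(I / 2) := by
    rintro ⟨z, hz⟩
    obtain ⟨i, -, rfl⟩ := Finset.mem_image.mp hz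
    exact hγ i
  have h1 := posDef_gram hE (fun v : {z // z ∈ (univ : Finset ι).image γ} ↦ ψ v.1)
    (fun v ↦ (hcont _).1) fun a b hab _ x hx ↦
      eq_zero_of_psi_sum_eq_zero t (fun v : {z // z ∈ (univ : Finset ι).image γ} ↦ v.1)
        Subtype.val_injective hval ψ hψ hab x hx
  have h2 := posSemidef_gram hE (fun v : {z // z ∈ (univ : Finset ι).image γ} ↦ Dψ v.1)
    fun v ↦ (hcont _).2
  have h12 := h1.add_posSemidef h2
  refine negEigenvalueCount_eq_conjPairCount_of_posDef γ hc (HMat t γ)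
    (fun a b ↦ (∫ u in Icc (-t) t, conj (ψ a u) * ψ b u) + ∫ u in Icc (-t) t, conj (Dψ a u) * Dψ b u)
    (fun i j ↦ ?_) ?_
  · rw [HMat_apply]
    exact H_eq_gram ht ψ Dψ hψ hDψ (hγ i) (hγ j)
  · convert h12 using 1
    ext a b
    rfl

end TheoremEight

/-! ## §H The discharge -/

/-- **Bombieri 2000, Theorem 9 — discharged**: the named fact `theorem9` holds. The standing symmetry
`γ ↦ −γ` of §8 and Lemma 12's proviso `0 ∉ Γ`, both part of the typed statement, are not used by
this proof. [cite: Bombieri2000Weil, §9 Theorem 9] -/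
theorem theorem9_holds : theorem9 := by
  intro E hE ι _ _ γ hc _
  exact ⟨negEigenvalueCount_KMat hE γ hc, fun hs _ ↦ negEigenvalueCount_KMatPM hE hs γ hc⟩


/-- **Bombieri 2000, Theorem 8 — discharged**: the named fact `theorem8` holds. Of the typed hypotheses
the symmetry `γ ↦ −γ` (with multiplicity) is not used; the proviso `γ ≠ ±i/2` is (it is exactly the
non-degeneracy of the Gram family). [cite: Bombieri2000Weil, §8 Theorem 8] -/
theorem theorem8_holds : theorem8 := by
  intro t ht ι _ _ γ hc _ hγ
  exact negEigenvalueCount_HMat ht γ hc hγ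

end Bombieri2000

end Literature.NumberTheory.LFunctions
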